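import Literature.NumberTheory.LFunctions.HalaszRestricted
import Literature.NumberTheory.LFunctions.MellinPlancherelShortDiff
import HarnessLib

/-!
# Halász's theorem for block-restricted sums in short intervals, I: the Granville–Soundararajan chain

Setting of `HalaszRestrictedEuler.lean` / `HalaszRestricted.lean`: `g : ℕ → ℂ` completely multiplicative with
`|g| ≤ 1`, a block system `blk i` (`i ∈ 𝓙`) of primes `≤ N`, `E = ⋃ blk i`, the restricted function
`a = g̃ 1_𝒮` (`restr 𝓙 blk g N`), its partial sums `S_a` and `A(y) = ∑_{n ≤ y} a(n) log n`.  This file runs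
the Granville–Soundararajan proof of Halász's theorem (Canad. J. Math. 2003, §§2–3; tree files
`HalaszPartialSummation`, `HalaszIntegration`, `HalaszRestricted`) for the SHORT multiplicative difference
`S_a(ρx) - S_a(x) = ∑_{x < n ≤ ρx, n ∈ 𝒮} g(n)`, `1 < ρ ≤ 2` (length `(ρ - 1)x`), instead of `S_a(x)`:

* (A1) `‖S_a(ρx) - S_a(x)‖ log x ≤ ∑_{d ≤ ρx} Λ(d) ‖S_a(ρx/d) - S_a(x/d)‖ + 2L(ρ-1)x + |E| log(ρx) + ((ρ-1)x + 1) log ρ`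
  (`norm_shortDiff_restr_mul_log_le`; the windows `(x/d, ρx/d]` all have the same ratio `ρ`);
* (A2) Abel summation against the prime number theorem, for the data `a_d = ‖S_a(ρx/d) - S_a(x/d)‖`, whose
  increments are bounded by `k_d(x) + k_d(ρx)` (`sum_vonMangoldt_mul_shortDiff_le`), and the comparison of
  `∑_d a_d` with `x ∫ ‖S_a(ρe^u) - S_a(e^u)‖ e^{-u} du` (`sum_shortDiff_div_le`);
* (A1, signed) `‖S_c(ρy) - S_c(y)‖ log y ≤ ‖A_c(ρy) - A_c(y)‖ + ((ρ-1)y + 1) log ρ` for any `1`-bounded `c`;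
* (3.7) the `α`-representation and Fubini, and (3.8) Cauchy–Schwarz, verbatim;
* the mean square `J(α) = ∫ ‖A(ρe^u) - A(e^u)‖² e^{-2(1+α)u} du = (1/2π) ∫ |ρ^s - 1|² |D_a(s)|²/|s|² dy`
  (`MellinPlancherelShortDiff`), bounded through `D_a = P_∁ 𝒢_a + ∑_i P_i 𝒢_{a_i}` (tree) by window bounds
  `‖𝒢_a‖, ‖𝒢_{a_i}‖ ≤ B` on `|y| ≤ T'` and the tree's dyadic tails — where now the `P`-mean values are taken
  AGAINST THE MULTIPLIER `|ρ^s - 1|²/|s|²`, i.e. (Plancherel backwards) as mean squares of `θ(ρy) - θ(y)`, which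
  the prime number theorem in short intervals bounds by `(ρ-1)y` (`MellinPlancherelShortDiff`): this gives
  `δ²/α` (`δ = ρ - 1`) where the mean value theorem would give the useless `δ²/α²`.

The outcome (`norm_shortDiff_restr_le_integral`, `inner_integral_short_le`) is the bound
`‖S_a(ρx) - S_a(x)‖ ≤ (x/log x) (17 ∫_{1/(2 log x)}^1 I(α) dα + O(1))` with
`I(α) ≤ B δ/α + (secondary terms)`: the `α`-integration with a REFINED choice of `B = B(α)` from the Euler
product (rather than the `1`-line window transported by Poisson smoothing) is carried out in
`HalaszRestrictedShortEuler.lean`, where it yields the sharp bound `≪ δx e^{-M/2}` near the minimising twist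
— the input for the window `𝒯₀ ∪ 𝒯₁` of Matomäki–Radziwiłł–Tao's Proposition A.3 with the printed middle term
`e^{-M} M`.

## References
* A. Granville, K. Soundararajan, *Decay of mean values of multiplicative functions*, Canad. J. Math. 55
  (2003), Lemma 2.1, §3b, Lemma 3.2. [cite: GranvilleSoundararajan2003, Lemma 2.1]
* K. Matomäki, M. Radziwiłł, T. Tao, *An averaged form of Chowla's conjecture*, Algebra & Number Theory 9
  (2015), Appendix A, proof of Proposition A.3 (the ranges `𝒯₀`, `𝒯₁`). [cite: MatomakiRadziwillTao2015, Appendix A]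

## Design choices
* No definitions: the short difference is always written `S c (ρ * y) - S c y`.
* `N` is a free truncation level with the block system at level `N`; the applications take `N = ⌊ρ x⌋`.
* Constants explicit and crude.
-/

noncomputable section

open Finset Real Complex MeasureTheory
open scoped ComplexConjugate

namespace Literature.NumberTheory.LFunctions

namespace Halasz

namespace Restricted

open MellinPlancherel (psum)
open ArithmeticFunction (vonMangoldt)

variable {ι : Type*} {𝓙 : Finset ι} {blk : ι → Finset ℕ} {g : ℕ → ℂ} {N : ℕ}

/-! ### Short differences of partial sums of a `1`-bounded sequence -/

section General

variable {c : ℕ → ℂ}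

/-- `S_c(y') - S_c(y) = ∑_{⌊y⌋ < n ≤ ⌊y'⌋} c(n)` for `y ≤ y'`. [folklore] -/
theorem S_sub_S_eq (c : ℕ → ℂ) {y y' : ℝ} (h : y ≤ y') :
    S c y' - S c y = ∑ n ∈ Finset.Ioc ⌊y⌋₊ ⌊y'⌋₊, c n :=
  MellinPlancherel.psum_sub_psum_eq c (Nat.floor_le_floor h)

/-- `‖S_c(y') - S_c(y)‖ ≤ ⌊y'⌋ - ⌊y⌋ ≤ y' - y + 1` for `1`-bounded `c` and `0 ≤ y ≤ y'`. [folklore] -/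
theorem norm_S_sub_S_le_sub_add_one (hc : ∀ n, ‖c n‖ ≤ 1) {y y' : ℝ} (hy : 0 ≤ y) (h : y ≤ y') :
    ‖S c y' - S c y‖ ≤ y' - y + 1 := by
  have h1 := norm_S_sub_S_le hc (Nat.floor_le_floor h)
  have h2 : (⌊y'⌋₊ : ℝ) ≤ y' := Nat.floor_le (hy.trans h)
  have h3 : y - 1 < (⌊y⌋₊ : ℝ) := by have := Nat.lt_floor_add_one y; linarith
  linarith

/-- `‖S_c(ρy) - S_c(y)‖ ≤ ρ y` for `1`-bounded `c`, `0 ≤ y`, `1 ≤ ρ` (for `y < 1` the lower sum is empty and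
`⌊ρy⌋ ≤ ρy`; for `y ≥ 1`, `(ρ-1)y + 1 ≤ ρy`). [folklore] -/
theorem norm_shortDiff_le_mul (hc : ∀ n, ‖c n‖ ≤ 1) {y ρ : ℝ} (hy : 0 ≤ y) (hρ : 1 ≤ ρ) :
    ‖S c (ρ * y) - S c y‖ ≤ ρ * y := by
  have hyy : y ≤ ρ * y := le_mul_of_one_le_left hy hρ
  have h1 := norm_S_sub_S_le hc (Nat.floor_le_floor hyy)
  have h2 : (⌊ρ * y⌋₊ : ℝ) ≤ ρ * y := Nat.floor_le (by positivity)
  rcases lt_or_ge y 1 with hy1 | hy1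
  · have : (⌊y⌋₊ : ℝ) = 0 := by rw [Nat.floor_eq_zero.2 hy1]; simp
    rw [this, sub_zero] at h1
    exact h1.trans h2
  · have h3 : y - 1 < (⌊y⌋₊ : ℝ) := by have := Nat.lt_floor_add_one y; linarith
    nlinarith

/-- The log-scale integrand `‖S_c(ρe^u) - S_c(e^u)‖ e^{-u}` is bounded by `ρ`. [folklore] -/
theorem shortDiffExp_le (hc : ∀ n, ‖c n‖ ≤ 1) {ρ : ℝ} (hρ : 1 ≤ ρ) (u : ℝ) :
    ‖S c (ρ * Real.exp u) - S c (Real.exp u)‖ * Real.exp (-u) ≤ ρ := by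
  have h := norm_shortDiff_le_mul hc (Real.exp_pos u).le hρ
  calc ‖S c (ρ * Real.exp u) - S c (Real.exp u)‖ * Real.exp (-u) ≤ ρ * Real.exp u * Real.exp (-u) := by gcongr
    _ = ρ := by rw [mul_assoc, ← Real.exp_add]; simp

/-- The log-scale integrand is measurable. [folklore] -/
theorem measurable_shortDiffExp (c : ℕ → ℂ) (ρ : ℝ) :
    Measurable fun u : ℝ => ‖S c (ρ * Real.exp u) - S c (Real.exp u)‖ * Real.exp (-u) :=
  (((measurable_S c).comp (Real.measurable_exp.const_mul ρ)).sub
    ((measurable_S c).comp Real.measurable_exp)).norm.mul (Real.measurable_exp.comp measurable_neg)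

/-- The log-scale integrand is interval integrable (bounded measurable). [folklore] -/
theorem intervalIntegrable_shortDiffExp (hc : ∀ n, ‖c n‖ ≤ 1) {ρ : ℝ} (hρ : 1 ≤ ρ) (a b : ℝ) :
    IntervalIntegrable (fun u : ℝ => ‖S c (ρ * Real.exp u) - S c (Real.exp u)‖ * Real.exp (-u)) volume a b := by
  refine IntervalIntegrable.mono_fun' (g := fun _ => ρ) intervalIntegrable_const
    (measurable_shortDiffExp c ρ).aestronglyMeasurable (Filter.Eventually.of_forall fun u => ?_)
  dsimp only
  rw [Real.norm_of_nonneg (by positivity)]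
  exact shortDiffExp_le hc hρ u

/-- **(A1), signed form, for short differences**: for `1`-bounded `c`, `1 ≤ y`, `1 ≤ ρ`,
`‖S_c(ρy) - S_c(y)‖ log y ≤ ‖∑_{y < n ≤ ρy} c(n) log n‖ + ((ρ - 1)y + 1) log ρ`
(`0 ≤ log n - log y ≤ log ρ` on the window). [cite: GranvilleSoundararajan2003, proof of Lemma 2.1] -/
theorem norm_shortDiff_mul_log_le_norm_sum (hc : ∀ n, ‖c n‖ ≤ 1) {y ρ : ℝ} (hy : 1 ≤ y) (hρ : 1 ≤ ρ) :
    ‖S c (ρ * y) - S c y‖ * Real.log y ≤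
      ‖∑ n ∈ Finset.Ioc ⌊y⌋₊ ⌊ρ * y⌋₊, c n * (Real.log n : ℂ)‖ + ((ρ - 1) * y + 1) * Real.log ρ := by
  have hy0 : 0 < y := by linarith
  have hyy : y ≤ ρ * y := le_mul_of_one_le_left hy0.le hρ
  have hlogρ : 0 ≤ Real.log ρ := Real.log_nonneg hρ
  rw [S_sub_S_eq c hyy]
  -- `log y · ∑ c(n) = ∑ c(n) log n - ∑ c(n) (log n - log y)`
  have hsplit : (∑ n ∈ Finset.Ioc ⌊y⌋₊ ⌊ρ * y⌋₊, c n) * (Real.log y : ℂ) =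
      ∑ n ∈ Finset.Ioc ⌊y⌋₊ ⌊ρ * y⌋₊, c n * (Real.log n : ℂ) -
        ∑ n ∈ Finset.Ioc ⌊y⌋₊ ⌊ρ * y⌋₊, c n * ((Real.log n - Real.log y : ℝ) : ℂ) := by
    rw [Finset.sum_mul, ← Finset.sum_sub_distrib]
    refine Finset.sum_congr rfl fun n _ => ?_
    push_cast; ring
  have hnorm : ‖S c (ρ * y) - S c y‖ * Real.log y =
      ‖(∑ n ∈ Finset.Ioc ⌊y⌋₊ ⌊ρ * y⌋₊, c n) * (Real.log y : ℂ)‖ := by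
    rw [norm_mul, Complex.norm_real, Real.norm_of_nonneg (Real.log_nonneg hy), S_sub_S_eq c hyy]
  rw [S_sub_S_eq c hyy] at hnorm
  rw [hnorm, hsplit]
  refine (norm_sub_le _ _).trans ?_
  gcongr
  -- the error sum
  have hterm : ∀ n ∈ Finset.Ioc ⌊y⌋₊ ⌊ρ * y⌋₊, ‖c n * ((Real.log n - Real.log y : ℝ) : ℂ)‖ ≤ Real.log ρ := by
    intro n hn
    rw [Finset.mem_Ioc] at hn
    have hn1 : y < n := Nat.lt_of_floor_lt hn.1
    have hn2 : (n : ℝ) ≤ ρ * y := by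
      have := Nat.floor_le (show 0 ≤ ρ * y by positivity)
      exact le_trans (by exact_mod_cast hn.2) this
    have hn0 : (0 : ℝ) < n := hy0.trans hn1
    have hlo : 0 ≤ Real.log n - Real.log y := by
      have := Real.log_le_log hy0 hn1.le; linarith
    have hhi : Real.log n - Real.log y ≤ Real.log ρ := by
      rw [← Real.log_div hn0.ne' hy0.ne']
      exact Real.log_le_log (by positivity) (by rw [div_le_iff₀ hy0]; exact hn2)
    rw [norm_mul, Complex.norm_real, Real.norm_of_nonneg hlo]
    calc ‖c n‖ * (Real.log n - Real.log y) ≤ 1 * Real.log ρ :=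
          mul_le_mul (hc n) hhi hlo zero_le_one
      _ = Real.log ρ := one_mul _
  calc ‖∑ n ∈ Finset.Ioc ⌊y⌋₊ ⌊ρ * y⌋₊, c n * ((Real.log n - Real.log y : ℝ) : ℂ)‖
      ≤ ∑ n ∈ Finset.Ioc ⌊y⌋₊ ⌊ρ * y⌋₊, Real.log ρ := (norm_sum_le _ _).trans (Finset.sum_le_sum hterm)
    _ = ((Finset.Ioc ⌊y⌋₊ ⌊ρ * y⌋₊).card : ℝ) * Real.log ρ := by rw [Finset.sum_const, nsmul_eq_mul]
    _ ≤ ((ρ - 1) * y + 1) * Real.log ρ := by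
        gcongr
        rw [Nat.card_Ioc, Nat.cast_sub (Nat.floor_le_floor hyy)]
        have h2 : (⌊ρ * y⌋₊ : ℝ) ≤ ρ * y := Nat.floor_le (by positivity)
        have h3 : y - 1 < (⌊y⌋₊ : ℝ) := by have := Nat.lt_floor_add_one y; linarith
        linarith

/-- The error sum in terms of `psum`: `∑_{y < n ≤ ρy} c(n) log n = A_c(ρy) - A_c(y)` with
`A_c = psum (c · log)`. [folklore] -/
theorem sum_Ioc_mul_log_eq_psum_sub (c : ℕ → ℂ) {y ρ : ℝ} (hy : 0 ≤ y) (hρ : 1 ≤ ρ) :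
    ∑ n ∈ Finset.Ioc ⌊y⌋₊ ⌊ρ * y⌋₊, c n * (Real.log n : ℂ) =
      psum (fun n => c n * (Real.log n : ℂ)) (ρ * y) - psum (fun n => c n * (Real.log n : ℂ)) y :=
  (MellinPlancherel.psum_sub_psum_eq _ (Nat.floor_le_floor (le_mul_of_one_le_left hy hρ))).symm

end General

/-! ### (A1) for the short difference of the restricted function -/

/-- The prime powers of primes of `E` up to `Y`: `∑_{d ≤ Y, (d,E) ≠ 1} Λ(d) ≤ |E| log Y` (`Y ≥ 1`). [folklore] -/
theorem sum_vonMangoldt_le_card_mul_log {E : Finset ℕ} (hE : ∀ p ∈ E, p.Prime) {Y : ℕ} (hY : 1 ≤ Y) :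
    ∑ d ∈ (Finset.Icc 1 Y).filter (fun d => ∃ p ∈ E, p ∣ d), (vonMangoldt d : ℝ) ≤ E.card * Real.log Y := by
  classical
  calc ∑ d ∈ (Finset.Icc 1 Y).filter (fun d => ∃ p ∈ E, p ∣ d), (vonMangoldt d : ℝ)
      ≤ ∑ d ∈ (Finset.Icc 1 Y).filter (fun d => ∃ p ∈ E, p ∣ d), ∑ p ∈ E, if p ∣ d then (vonMangoldt d : ℝ) else 0 := by
        refine Finset.sum_le_sum fun d hd => ?_
        obtain ⟨p₀, hp₀, hdvd⟩ := (Finset.mem_filter.mp hd).2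
        calc (vonMangoldt d : ℝ) = if p₀ ∣ d then (vonMangoldt d : ℝ) else 0 := by rw [if_pos hdvd]
          _ ≤ ∑ p ∈ E, if p ∣ d then (vonMangoldt d : ℝ) else 0 :=
              Finset.single_le_sum (f := fun p => if p ∣ d then (vonMangoldt d : ℝ) else 0)
                (fun p _ => by split_ifs <;> [exact ArithmeticFunction.vonMangoldt_nonneg; exact le_rfl]) hp₀
    _ ≤ ∑ d ∈ Finset.Icc 1 Y, ∑ p ∈ E, if p ∣ d then (vonMangoldt d : ℝ) else 0 :=
        Finset.sum_le_sum_of_subset_of_nonneg (Finset.filter_subset _ _) fun d _ _ =>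
          Finset.sum_nonneg fun p _ => by
            split_ifs <;> [exact ArithmeticFunction.vonMangoldt_nonneg; exact le_rfl]
    _ = ∑ p ∈ E, ∑ d ∈ (Finset.Icc 1 Y).filter (p ∣ ·), (vonMangoldt d : ℝ) := by
        rw [Finset.sum_comm]
        refine Finset.sum_congr rfl fun p _ => ?_
        rw [Finset.sum_filter]
    _ ≤ ∑ p ∈ E, Real.log Y := Finset.sum_le_sum fun p hp => sum_vonMangoldt_filter_dvd_le (hE p hp) hY
    _ = E.card * Real.log Y := by rw [Finset.sum_const, nsmul_eq_mul]

/-- The double-sum identity for a short difference: with `Y' = ⌊ρx⌋`,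
`∑_{x < n ≤ ρx} a(n) log n = ∑_{d ≤ Y'} Λ(d) ∑_{⌊x/d⌋ < m ≤ ⌊ρx/d⌋} a(dm)`. [folklore] -/
theorem sum_Ioc_mul_log_eq_sum_sum (a : ℕ → ℂ) {x ρ : ℝ} (hx : 0 ≤ x) (hρ : 1 ≤ ρ) :
    ∑ n ∈ Finset.Ioc ⌊x⌋₊ ⌊ρ * x⌋₊, a n * (Real.log n : ℂ) =
      ∑ d ∈ Finset.Icc 1 ⌊ρ * x⌋₊, (vonMangoldt d : ℂ) *
        ∑ m ∈ Finset.Ioc (⌊x⌋₊ / d) (⌊ρ * x⌋₊ / d), a (d * m) := by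
  have hxx : x ≤ ρ * x := le_mul_of_one_le_left hx hρ
  have hfl : ⌊x⌋₊ ≤ ⌊ρ * x⌋₊ := Nat.floor_le_floor hxx
  -- both full sums as double sums
  have h1 := sum_mul_log_eq_sum_sum a (ρ * x)
  have h2 := sum_mul_log_eq_sum_sum a x
  -- extend the `d`-range of the second to `⌊ρx⌋` (empty inner sums)
  have h2' : ∑ n ∈ Finset.Icc 1 ⌊x⌋₊, a n * (Real.log n : ℂ) =
      ∑ d ∈ Finset.Icc 1 ⌊ρ * x⌋₊, ∑ m ∈ Finset.Icc 1 (⌊x⌋₊ / d), (vonMangoldt d : ℂ) * a (d * m) := by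
    rw [h2]
    refine (Finset.sum_subset (Finset.Icc_subset_Icc_right hfl) fun d hd hd' => ?_).symm
      |>.symm
    rw [Finset.mem_Icc] at hd hd'
    have : ⌊x⌋₊ / d = 0 := Nat.div_eq_of_lt (by omega)
    rw [this]; simp
  have hdiff : ∑ n ∈ Finset.Ioc ⌊x⌋₊ ⌊ρ * x⌋₊, a n * (Real.log n : ℂ) =
      ∑ n ∈ Finset.Icc 1 ⌊ρ * x⌋₊, a n * (Real.log n : ℂ) - ∑ n ∈ Finset.Icc 1 ⌊x⌋₊, a n * (Real.log n : ℂ) := by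
    rw [← MellinPlancherel.psum_sub_psum_eq _ hfl]; rfl
  rw [hdiff, h1, h2', ← Finset.sum_sub_distrib]
  refine Finset.sum_congr rfl fun d _ => ?_
  rw [Finset.mul_sum]
  have hsub : ⌊x⌋₊ / d ≤ ⌊ρ * x⌋₊ / d := Nat.div_le_div_right hfl
  have e1 : Finset.Icc 1 (⌊ρ * x⌋₊ / d) = Finset.Ioc 0 (⌊ρ * x⌋₊ / d) := rfl
  have e2 : Finset.Icc 1 (⌊x⌋₊ / d) = Finset.Ioc 0 (⌊x⌋₊ / d) := rfl
  rw [e1, e2, ← Finset.sum_Ioc_consecutive _ (Nat.zero_le _) hsub]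
  ring

/-- **(A1) for the short difference of the restricted function.**  For a block system at level `N`, `g`
completely multiplicative with `|g| ≤ 1`, `∑_{p ∈ E} log p/p ≤ L`, `1 ≤ x` and `1 ≤ ρ`:
`‖S_a(ρx) - S_a(x)‖ log x ≤ ∑_{d ≤ ρx} Λ(d) ‖S_a(ρx/d) - S_a(x/d)‖ + 2L(ρ - 1)x + |E| log(ρx) + ((ρ-1)x + 1) log ρ`.
For `d = p^k`, `p ∉ E`: `a(dm) = g̃(d) a(m)`; the prime powers of block primes are bounded trivially.
[cite: GranvilleSoundararajan2003, Lemma 2.1] -/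
theorem norm_shortDiff_restr_mul_log_le [DecidableEq ι] (h : IsBlockSystem 𝓙 blk N)
    (hg : ∀ m n, g (m * n) = g m * g n) (hgb : ∀ n, ‖g n‖ ≤ 1) {L : ℝ}
    (hL : ∑ p ∈ 𝓙.biUnion blk, Real.log p / p ≤ L) {x ρ : ℝ} (hx : 1 ≤ x) (hρ : 1 ≤ ρ) :
    ‖S (restr 𝓙 blk g N) (ρ * x) - S (restr 𝓙 blk g N) x‖ * Real.log x ≤
      ∑ d ∈ Finset.Icc 1 ⌊ρ * x⌋₊, vonMangoldt d *
          ‖S (restr 𝓙 blk g N) (ρ * x / d) - S (restr 𝓙 blk g N) (x / d)‖ +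
        2 * L * ((ρ - 1) * x) + (𝓙.biUnion blk).card * Real.log (ρ * x) + ((ρ - 1) * x + 1) * Real.log ρ := by
  set a := restr 𝓙 blk g N with ha
  set E := 𝓙.biUnion blk with hE
  have hEprime : ∀ q ∈ E, q.Prime := fun q hq => h.prime_of_mem_biUnion (t := 𝓙) le_rfl hq
  have hblkprime : ∀ i ∈ 𝓙, ∀ q ∈ blk i, q.Prime := fun i hi q hq => h.prime_of_mem hi hq
  have hx0 : 0 < x := by linarith
  have hxx : x ≤ ρ * x := le_mul_of_one_le_left hx0.le hρ
  have hρx1 : 1 ≤ ρ * x := hx.trans hxx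
  have hab : ∀ n, ‖a n‖ ≤ 1 := norm_restr_le_one hgb
  set Y := ⌊ρ * x⌋₊ with hY
  have hY1 : 1 ≤ Y := Nat.le_floor (by simpa using hρx1)
  -- the inner sums
  set T : ℕ → ℂ := fun d => ∑ m ∈ Finset.Ioc (⌊x⌋₊ / d) (Y / d), (vonMangoldt d : ℂ) * a (d * m) with hT
  have hTle : ∀ d ∈ Finset.Icc 1 Y, ‖T d‖ ≤ vonMangoldt d * ‖S a (ρ * x / d) - S a (x / d)‖ +
      (if ∃ p ∈ E, p ∣ d then ((ρ - 1) * x) * ((vonMangoldt d : ℝ) / d) + vonMangoldt d else 0) := by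
    intro d hd
    rw [Finset.mem_Icc] at hd
    have hd0 : (0 : ℝ) < d := by exact_mod_cast hd.1
    by_cases hΛ : (vonMangoldt d : ℝ) = 0
    · have : T d = 0 := Finset.sum_eq_zero fun m _ => by simp [hΛ]
      rw [this, norm_zero, hΛ]
      simp only [zero_mul, zero_div, mul_zero, add_zero, ite_self, le_refl]
    obtain ⟨p, k, hp, hk, rfl⟩ := exists_eq_pow_of_vonMangoldt_ne_zero hΛ
    -- floors: `⌊x⌋ / d = ⌊x/d⌋`, `Y / d = ⌊ρx/d⌋`
    have hfl1 : ⌊x⌋₊ / p ^ k = ⌊x / (p ^ k : ℕ)⌋₊ := (Nat.floor_div_natCast x (p ^ k)).symm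
    have hfl2 : Y / p ^ k = ⌊ρ * x / (p ^ k : ℕ)⌋₊ := (Nat.floor_div_natCast (ρ * x) (p ^ k)).symm
    have hle : x / (p ^ k : ℕ) ≤ ρ * x / (p ^ k : ℕ) := div_le_div_of_nonneg_right hxx hd0.le
    by_cases hpE : p ∈ E
    · -- crude bound
      have hex : ∃ q ∈ E, q ∣ p ^ k := ⟨p, hpE, dvd_pow_self p hk.ne'⟩
      rw [if_pos hex]
      have h1 : ‖T (p ^ k)‖ ≤ ∑ m ∈ Finset.Ioc (⌊x⌋₊ / p ^ k) (Y / p ^ k), (vonMangoldt (p ^ k) : ℝ) := by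
        refine (norm_sum_le _ _).trans (Finset.sum_le_sum fun m _ => ?_)
        rw [norm_mul, Complex.norm_real, Real.norm_of_nonneg ArithmeticFunction.vonMangoldt_nonneg]
        exact mul_le_of_le_one_right ArithmeticFunction.vonMangoldt_nonneg (hab _)
      rw [Finset.sum_const, Nat.card_Ioc, nsmul_eq_mul] at h1
      have hcount : (((Y / p ^ k - ⌊x⌋₊ / p ^ k : ℕ)) : ℝ) ≤ (ρ - 1) * x / (p ^ k : ℕ) + 1 := by
        rw [hfl1, hfl2, Nat.cast_sub (Nat.floor_le_floor hle)]
        have e1 : (⌊ρ * x / (p ^ k : ℕ)⌋₊ : ℝ) ≤ ρ * x / (p ^ k : ℕ) := Nat.floor_le (by positivity)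
        have e2 : x / (p ^ k : ℕ) - 1 < (⌊x / (p ^ k : ℕ)⌋₊ : ℝ) := by
          have := Nat.lt_floor_add_one (x / (p ^ k : ℕ)); linarith
        have e3 : ρ * x / (p ^ k : ℕ) - x / (p ^ k : ℕ) = (ρ - 1) * x / (p ^ k : ℕ) := by ring
        linarith
      have hS0 : 0 ≤ vonMangoldt (p ^ k) * ‖S a (ρ * x / (p ^ k : ℕ)) - S a (x / (p ^ k : ℕ))‖ := by positivity
      calc ‖T (p ^ k)‖ ≤ ((Y / p ^ k - ⌊x⌋₊ / p ^ k : ℕ) : ℝ) * vonMangoldt (p ^ k) := h1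
        _ ≤ ((ρ - 1) * x / (p ^ k : ℕ) + 1) * vonMangoldt (p ^ k) := by
            gcongr
        _ = (ρ - 1) * x * ((vonMangoldt (p ^ k) : ℝ) / (p ^ k : ℕ)) + vonMangoldt (p ^ k) := by ring
        _ ≤ _ := le_add_of_nonneg_left hS0
    · -- exact factorisation `a(dm) = g̃(d) a(m)`
      have hpE' : ∀ i ∈ 𝓙, p ∉ blk i := fun i hi hpi => hpE (Finset.mem_biUnion.mpr ⟨i, hi, hpi⟩)
      have hfac : ∀ m : ℕ, a (p ^ k * m) = smoothCut g N (p ^ k) * a m := by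
        intro m
        simp only [ha, restr]
        rw [smoothCut_mul hg, blockInd_primePow_mul hblkprime hp hpE' m]
        ring
      have hTeq : T (p ^ k) = (vonMangoldt (p ^ k) : ℂ) * smoothCut g N (p ^ k) *
          (S a (ρ * x / (p ^ k : ℕ)) - S a (x / (p ^ k : ℕ))) := by
        simp only [hT]
        rw [S_sub_S_eq a hle, ← hfl1, ← hfl2, Finset.mul_sum]
        exact Finset.sum_congr rfl fun m _ => by rw [hfac m]; ring
      have hnot : ¬ ∃ q ∈ E, q ∣ p ^ k := by
        rintro ⟨q, hq, hqd⟩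
        exact hpE ((prime_dvd_primePow_iff hp (hEprime q hq) hk).mp hqd ▸ hq)
      rw [if_neg hnot, add_zero, hTeq, norm_mul, norm_mul, Complex.norm_real,
        Real.norm_of_nonneg ArithmeticFunction.vonMangoldt_nonneg]
      calc vonMangoldt (p ^ k) * ‖smoothCut g N (p ^ k)‖ * ‖S a (ρ * x / (p ^ k : ℕ)) - S a (x / (p ^ k : ℕ))‖
          ≤ vonMangoldt (p ^ k) * 1 * ‖S a (ρ * x / (p ^ k : ℕ)) - S a (x / (p ^ k : ℕ))‖ := by
            gcongr
            exact norm_smoothCut_le hgb _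
        _ = _ := by rw [mul_one]
  -- assemble
  have h0 := norm_shortDiff_mul_log_le_norm_sum hab hx hρ
  rw [sum_Ioc_mul_log_eq_sum_sum a hx0.le hρ] at h0
  have herr : ∑ d ∈ Finset.Icc 1 Y,
      (if ∃ p ∈ E, p ∣ d then ((ρ - 1) * x) * ((vonMangoldt d : ℝ) / d) + vonMangoldt d else 0) ≤
      2 * L * ((ρ - 1) * x) + E.card * Real.log (ρ * x) := by
    rw [← Finset.sum_filter, Finset.sum_add_distrib, ← Finset.mul_sum]
    have e1 := sum_vonMangoldt_div_le_of_primes hEprime Y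
    have e2 := sum_vonMangoldt_le_card_mul_log hEprime hY1
    have hlogY : Real.log Y ≤ Real.log (ρ * x) :=
      Real.log_le_log (by exact_mod_cast hY1) (Nat.floor_le (by positivity))
    have hρx0 : 0 ≤ (ρ - 1) * x := by nlinarith
    calc (ρ - 1) * x * ∑ d ∈ (Finset.Icc 1 Y).filter (fun d => ∃ p ∈ E, p ∣ d), (vonMangoldt d : ℝ) / d +
          ∑ d ∈ (Finset.Icc 1 Y).filter (fun d => ∃ p ∈ E, p ∣ d), (vonMangoldt d : ℝ)
        ≤ (ρ - 1) * x * (2 * ∑ p ∈ E, Real.log p / p) + E.card * Real.log Y := by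
          gcongr
      _ ≤ (ρ - 1) * x * (2 * L) + E.card * Real.log (ρ * x) := by
          gcongr
      _ = 2 * L * ((ρ - 1) * x) + E.card * Real.log (ρ * x) := by ring
  have h1 : ‖∑ d ∈ Finset.Icc 1 Y, (vonMangoldt d : ℂ) * ∑ m ∈ Finset.Ioc (⌊x⌋₊ / d) (Y / d), a (d * m)‖ ≤
      ∑ d ∈ Finset.Icc 1 Y, vonMangoldt d * ‖S a (ρ * x / d) - S a (x / d)‖ +
        (2 * L * ((ρ - 1) * x) + E.card * Real.log (ρ * x)) := by
    have hTd : ∀ d ∈ Finset.Icc 1 Y, (vonMangoldt d : ℂ) * ∑ m ∈ Finset.Ioc (⌊x⌋₊ / d) (Y / d), a (d * m) = T d := by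
      intro d _; simp only [hT, Finset.mul_sum]
    rw [Finset.sum_congr rfl hTd]
    refine (norm_sum_le _ _).trans ((Finset.sum_le_sum hTle).trans ?_)
    rw [Finset.sum_add_distrib]
    linarith [herr]
  linarith

/-! ### (A2) Abel summation against the prime number theorem, abstract data -/

/-- **Abel summation against the prime number theorem, abstract form**: if `a : ℕ → ℝ` satisfies
`a(Y+1) = 0` and `|a_d - a_{d+1}| ≤ κ_d` for `1 ≤ d ≤ Y`, then
`∑_{d ≤ Y} Λ(d) a_d ≤ ∑_{d ≤ Y} a_d + ∑_{d ≤ Y} |ψ(d) - d| κ_d`. [cite: GranvilleSoundararajan2003, proof of Lemma 2.1] -/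
theorem sum_vonMangoldt_mul_le_of_increments (a κ : ℕ → ℝ) (Y : ℕ) (haY : a (Y + 1) = 0)
    (hκ : ∀ d ∈ Finset.Icc 1 Y, |a d - a (d + 1)| ≤ κ d) :
    ∑ d ∈ Finset.Icc 1 Y, vonMangoldt d * a d ≤
      ∑ d ∈ Finset.Icc 1 Y, a d + ∑ d ∈ Finset.Icc 1 Y, |Chebyshev.psi d - d| * κ d := by
  have h1 := abel_sum (fun d : ℕ => Chebyshev.psi d) a Y
  have h2 := abel_sum (fun d : ℕ => (d : ℝ)) a Y
  simp only [Nat.cast_zero, Chebyshev.psi_zero, zero_mul, sub_zero, haY, mul_zero, add_zero] at h1 h2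
  have h1' : ∑ d ∈ Finset.Icc 1 Y, vonMangoldt d * a d =
      ∑ d ∈ Finset.Icc 1 Y, Chebyshev.psi d * (a d - a (d + 1)) := by
    rw [← h1]
    refine Finset.sum_congr rfl fun d hd => ?_
    rw [Finset.mem_Icc] at hd
    rw [psi_sub_psi_pred hd.1]
  have h2' : ∑ d ∈ Finset.Icc 1 Y, a d = ∑ d ∈ Finset.Icc 1 Y, (d : ℝ) * (a d - a (d + 1)) := by
    rw [← h2]
    refine Finset.sum_congr rfl fun d hd => ?_
    rw [Finset.mem_Icc] at hd
    rw [Nat.cast_sub hd.1]; push_cast; ring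
  rw [h1', h2', ← Finset.sum_add_distrib]
  refine Finset.sum_le_sum fun d hd => ?_
  have hk := hκ d hd
  have : (Chebyshev.psi d - d) * (a d - a (d + 1)) ≤ |Chebyshev.psi d - d| * κ d := by
    calc (Chebyshev.psi d - d) * (a d - a (d + 1)) ≤ |(Chebyshev.psi d - d) * (a d - a (d + 1))| := le_abs_self _
      _ = |Chebyshev.psi d - d| * |a d - a (d + 1)| := abs_mul _ _
      _ ≤ |Chebyshev.psi d - d| * κ d := by gcongr
  linarith

/-- `∑_{d ≤ Y} k_d(x) ≤ ⌊x⌋` for every `Y` (telescoping; the full sum over `d ≤ ⌊x⌋` is `= ⌊x⌋`). [folklore] -/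
theorem sum_kk_le (x : ℝ) (Y : ℕ) : ∑ d ∈ Finset.Icc 1 Y, kk x d ≤ ⌊x⌋₊ := by
  have h := sum_Icc_sub_succ (fun d : ℕ => (⌊x / d⌋₊ : ℝ)) Y
  simp only [Nat.cast_add, Nat.cast_one] at h
  unfold kk
  have h2 : (0 : ℝ) ≤ ⌊x / ((Y : ℝ) + 1)⌋₊ := Nat.cast_nonneg _
  rw [h]
  simp only [div_one]
  linarith

/-- `k_d(x) = 0` for `d ≥ ⌊x⌋ + 1` (both floors vanish). [folklore] -/
theorem kk_eq_zero_of_lt {x : ℝ} {d : ℕ} (hd : ⌊x⌋₊ < d) : kk x d = 0 := by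
  unfold kk
  have hd0 : (0 : ℝ) < d := by exact_mod_cast (Nat.zero_le _).trans_lt hd
  have h1 : x / d < 1 := by
    rw [div_lt_one hd0]; exact Nat.lt_of_floor_lt hd
  have h2 : x / (d + 1) < 1 := by
    rw [div_lt_one (by linarith)]; have := Nat.lt_of_floor_lt hd; linarith
  rw [Nat.floor_eq_zero.2 h1, Nat.floor_eq_zero.2 h2]; simp

/-- The increments of the short-difference data: for `1`-bounded `c`, `0 ≤ x`, `1 ≤ ρ`, `1 ≤ d`,
`|‖S_c(ρx/d) - S_c(x/d)‖ - ‖S_c(ρx/(d+1)) - S_c(x/(d+1))‖| ≤ k_d(x) + k_d(ρx)`. [folklore] -/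
theorem abs_norm_shortDiff_sub_le {c : ℕ → ℂ} (hc : ∀ n, ‖c n‖ ≤ 1) {x ρ : ℝ} (hx : 0 ≤ x) (hρ : 1 ≤ ρ)
    {d : ℕ} (hd : 1 ≤ d) :
    |‖S c (ρ * x / d) - S c (x / d)‖ - ‖S c (ρ * x / (d + 1)) - S c (x / (d + 1))‖| ≤ kk x d + kk (ρ * x) d := by
  have hρx : 0 ≤ ρ * x := by nlinarith
  have h1 := norm_S_sub_S_le hc (floor_div_succ_le hx hd)
  have h2 := norm_S_sub_S_le hc (floor_div_succ_le hρx hd)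
  have key : ‖(S c (ρ * x / d) - S c (x / d)) - (S c (ρ * x / (d + 1)) - S c (x / (d + 1)))‖ ≤ kk x d + kk (ρ * x) d := by
    have e : (S c (ρ * x / d) - S c (x / d)) - (S c (ρ * x / (d + 1)) - S c (x / (d + 1))) =
        (S c (ρ * x / d) - S c (ρ * x / (d + 1))) - (S c (x / d) - S c (x / (d + 1))) := by ring
    rw [e]
    refine (norm_sub_le _ _).trans ?_
    unfold kk
    linarith
  have := abs_norm_sub_norm_le (S c (ρ * x / d) - S c (x / d)) (S c (ρ * x / (d + 1)) - S c (x / (d + 1)))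
  linarith

/-- **(A2), sum side**: for `1`-bounded `c`, `x ≥ 3`, `1 ≤ ρ ≤ 2`, with `Y = ⌊ρx⌋` and `C` the constant of
`Halasz.exists_sum_abs_psi_sub_mul_kk_le`:
`∑_{d ≤ Y} Λ(d) ‖S_c(ρx/d) - S_c(x/d)‖ ≤ ∑_{d ≤ Y} ‖S_c(ρx/d) - S_c(x/d)‖ + 3 C x`. [folklore] -/
theorem sum_vonMangoldt_mul_shortDiff_le {C : ℝ}
    (hC : ∀ x : ℝ, 3 ≤ x → ∑ d ∈ Finset.Icc 1 ⌊x⌋₊, |Chebyshev.psi d - d| * kk x d ≤ C * x)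
    {c : ℕ → ℂ} (hc : ∀ n, ‖c n‖ ≤ 1) {x ρ : ℝ} (hx : 3 ≤ x) (hρ : 1 ≤ ρ) (hρ2 : ρ ≤ 2) :
    ∑ d ∈ Finset.Icc 1 ⌊ρ * x⌋₊, vonMangoldt d * ‖S c (ρ * x / d) - S c (x / d)‖ ≤
      ∑ d ∈ Finset.Icc 1 ⌊ρ * x⌋₊, ‖S c (ρ * x / d) - S c (x / d)‖ + 3 * C * x := by
  have hx0 : 0 ≤ x := by linarith
  have hρx : 0 ≤ ρ * x := by nlinarith
  have hρx3 : 3 ≤ ρ * x := by nlinarith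
  set Y := ⌊ρ * x⌋₊ with hY
  set a : ℕ → ℝ := fun d => ‖S c (ρ * x / d) - S c (x / d)‖ with ha
  have haY : a (Y + 1) = 0 := by
    simp only [ha]
    have h1 : ρ * x / (Y + 1 : ℕ) < 1 := by
      rw [div_lt_one (by positivity), hY]; push_cast; exact Nat.lt_floor_add_one _
    have h2 : x / (Y + 1 : ℕ) < 1 := lt_of_le_of_lt (div_le_div_of_nonneg_right
      (le_mul_of_one_le_left hx0 hρ) (by positivity)) h1
    rw [S_of_lt_one c h1, S_of_lt_one c h2, sub_zero, norm_zero]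
  have hκ : ∀ d ∈ Finset.Icc 1 Y, |a d - a (d + 1)| ≤ kk x d + kk (ρ * x) d := by
    intro d hd
    rw [Finset.mem_Icc] at hd
    have := abs_norm_shortDiff_sub_le hc hx0 hρ hd.1
    simp only [ha]
    push_cast
    exact this
  have hmain := sum_vonMangoldt_mul_le_of_increments a (fun d => kk x d + kk (ρ * x) d) Y haY hκ
  -- the error: `∑ |ψ d - d| (k_d(x) + k_d(ρx)) ≤ C x + C ρ x ≤ 3 C x`
  have hC0 : 0 ≤ C := by
    have h := hC 3 le_rfl
    have h0 : 0 ≤ ∑ d ∈ Finset.Icc 1 ⌊(3:ℝ)⌋₊, |Chebyshev.psi d - d| * kk 3 d :=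
      Finset.sum_nonneg fun d hd => mul_nonneg (abs_nonneg _) (kk_nonneg (by norm_num) (Finset.mem_Icc.1 hd).1)
    nlinarith
  have herr : ∑ d ∈ Finset.Icc 1 Y, |Chebyshev.psi d - d| * (kk x d + kk (ρ * x) d) ≤ 3 * C * x := by
    have e2 := hC (ρ * x) hρx3
    -- the `x`-part: terms with `d > ⌊x⌋` vanish
    have e1 : ∑ d ∈ Finset.Icc 1 Y, |Chebyshev.psi d - d| * kk x d ≤ C * x := by
      have hsub : Finset.Icc 1 ⌊x⌋₊ ⊆ Finset.Icc 1 Y :=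
        Finset.Icc_subset_Icc_right (Nat.floor_le_floor (le_mul_of_one_le_left hx0 hρ))
      rw [← Finset.sum_subset hsub]
      · exact hC x hx
      · intro d hd hd'
        rw [Finset.mem_Icc] at hd hd'
        rw [kk_eq_zero_of_lt (by omega), mul_zero]
    calc ∑ d ∈ Finset.Icc 1 Y, |Chebyshev.psi d - d| * (kk x d + kk (ρ * x) d)
        = ∑ d ∈ Finset.Icc 1 Y, |Chebyshev.psi d - d| * kk x d + ∑ d ∈ Finset.Icc 1 Y, |Chebyshev.psi d - d| * kk (ρ * x) d := by
          rw [← Finset.sum_add_distrib]; exact Finset.sum_congr rfl fun d _ => by ring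
      _ ≤ C * x + C * (ρ * x) := add_le_add e1 e2
      _ ≤ 3 * C * x := by
          have : C * (ρ * x) ≤ C * (2 * x) := mul_le_mul_of_nonneg_left (by nlinarith) hC0
          linarith
  simp only [ha] at hmain
  linarith

/-- The per-`d` inequality for short differences: for `1`-bounded `c`, `0 < x`, `1 ≤ ρ`, `1 ≤ d`,
`‖S_c(ρx/d) - S_c(x/d)‖ - (k_d(x) + k_d(ρx)) ≤ x ∫_{log(x/(d+1))}^{log(x/d)} ‖S_c(ρe^u) - S_c(e^u)‖ e^{-u} du`. [folklore] -/
theorem norm_shortDiff_div_sub_kk_le {c : ℕ → ℂ} (hc : ∀ n, ‖c n‖ ≤ 1) {x ρ : ℝ} (hx : 0 < x) (hρ : 1 ≤ ρ)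
    {d : ℕ} (hd : 1 ≤ d) :
    ‖S c (ρ * x / d) - S c (x / d)‖ - (kk x d + kk (ρ * x) d) ≤
      x * ∫ u in Real.log (x / (d + 1))..Real.log (x / d), ‖S c (ρ * Real.exp u) - S c (Real.exp u)‖ * Real.exp (-u) := by
  have hd0 : (0 : ℝ) < d := by exact_mod_cast hd
  have hρ0 : 0 < ρ := by linarith
  set α := Real.log (x / (d + 1)) with hα
  set β := Real.log (x / d) with hβ
  have hxd1 : 0 < x / (d + 1) := by positivity
  have hxd : 0 < x / d := by positivity
  have hle : x / (d + 1) ≤ x / d := div_le_div_of_nonneg_left hx.le hd0 (by linarith)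
  have hαβ : α ≤ β := Real.log_le_log hxd1 hle
  set V : ℝ := ‖S c (ρ * x / d) - S c (x / d)‖ - (kk x d + kk (ρ * x) d) with hV
  -- pointwise lower bound on `[α, β]`
  have hpt : ∀ u ∈ Set.Icc α β, V * Real.exp (-u) ≤ ‖S c (ρ * Real.exp u) - S c (Real.exp u)‖ * Real.exp (-u) := by
    intro u hu
    refine mul_le_mul_of_nonneg_right ?_ (Real.exp_pos _).le
    have hu1 : x / (d + 1) ≤ Real.exp u := by
      calc x / (d + 1) = Real.exp α := (Real.exp_log hxd1).symm
        _ ≤ Real.exp u := Real.exp_le_exp.mpr hu.1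
    have hu2 : Real.exp u ≤ x / d := by
      calc Real.exp u ≤ Real.exp β := Real.exp_le_exp.mpr hu.2
        _ = x / d := Real.exp_log hxd
    have hfl2 : ⌊Real.exp u⌋₊ ≤ ⌊x / d⌋₊ := Nat.floor_le_floor hu2
    have hfl1 : ⌊x / (d + 1)⌋₊ ≤ ⌊Real.exp u⌋₊ := Nat.floor_le_floor hu1
    have hfl2' : ⌊ρ * Real.exp u⌋₊ ≤ ⌊ρ * x / d⌋₊ :=
      Nat.floor_le_floor (by rw [mul_div_assoc]; exact mul_le_mul_of_nonneg_left hu2 hρ0.le)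
    have hfl1' : ⌊ρ * x / (d + 1)⌋₊ ≤ ⌊ρ * Real.exp u⌋₊ :=
      Nat.floor_le_floor (by rw [mul_div_assoc]; exact mul_le_mul_of_nonneg_left hu1 hρ0.le)
    have hs1 := norm_S_sub_S_le hc hfl2
    have hs2 := norm_S_sub_S_le hc hfl2'
    have htri : ‖S c (ρ * x / d) - S c (x / d)‖ ≤ ‖S c (ρ * Real.exp u) - S c (Real.exp u)‖ +
        ‖S c (ρ * x / d) - S c (ρ * Real.exp u)‖ + ‖S c (x / d) - S c (Real.exp u)‖ := by
      have e : S c (ρ * x / d) - S c (x / d) = (S c (ρ * Real.exp u) - S c (Real.exp u)) +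
          (S c (ρ * x / d) - S c (ρ * Real.exp u)) - (S c (x / d) - S c (Real.exp u)) := by ring
      rw [e]
      exact (norm_sub_le _ _).trans (by gcongr; exact norm_add_le _ _)
    have hk1 : (⌊x / d⌋₊ : ℝ) - ⌊Real.exp u⌋₊ ≤ kk x d := by
      unfold kk
      have : (⌊x / (d + 1)⌋₊ : ℝ) ≤ ⌊Real.exp u⌋₊ := by exact_mod_cast hfl1
      linarith
    have hk2 : (⌊ρ * x / d⌋₊ : ℝ) - ⌊ρ * Real.exp u⌋₊ ≤ kk (ρ * x) d := by
      unfold kk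
      have : (⌊ρ * x / (d + 1)⌋₊ : ℝ) ≤ ⌊ρ * Real.exp u⌋₊ := by exact_mod_cast hfl1'
      linarith
    rw [hV]
    linarith
  -- integrate
  have hint : IntervalIntegrable (fun u : ℝ => ‖S c (ρ * Real.exp u) - S c (Real.exp u)‖ * Real.exp (-u)) volume α β :=
    intervalIntegrable_shortDiffExp hc hρ _ _
  have hI : ∫ u in α..β, V * Real.exp (-u) = V * ((d + 1) / x - d / x) := by
    rw [intervalIntegral.integral_const_mul]
    congr 1
    rw [intervalIntegral.integral_comp_neg (fun u => Real.exp u), integral_exp]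
    rw [hα, hβ, Real.exp_neg, Real.exp_neg, Real.exp_log hxd1, Real.exp_log hxd, inv_div, inv_div]
  have hmono : ∫ u in α..β, V * Real.exp (-u) ≤
      ∫ u in α..β, ‖S c (ρ * Real.exp u) - S c (Real.exp u)‖ * Real.exp (-u) :=
    intervalIntegral.integral_mono_on hαβ ((continuous_const.mul (by fun_prop)).intervalIntegrable _ _) hint hpt
  rw [hI] at hmono
  have hx1 : V * ((d + 1) / x - d / x) = V / x := by field_simp; ring
  rw [hx1, div_le_iff₀ hx] at hmono
  linarith

/-- **(A2), sum versus integral**: for `1`-bounded `c`, `x ≥ 1`, `1 ≤ ρ ≤ 2`,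
`∑_{d ≤ ρx} ‖S_c(ρx/d) - S_c(x/d)‖ ≤ x ∫_0^{log x} ‖S_c(ρe^u) - S_c(e^u)‖ e^{-u} du + 4x + 3`. [folklore] -/
theorem sum_shortDiff_div_le {c : ℕ → ℂ} (hc : ∀ n, ‖c n‖ ≤ 1) {x ρ : ℝ} (hx : 1 ≤ x) (hρ : 1 ≤ ρ)
    (hρ2 : ρ ≤ 2) :
    ∑ d ∈ Finset.Icc 1 ⌊ρ * x⌋₊, ‖S c (ρ * x / d) - S c (x / d)‖ ≤
      x * (∫ u in (0:ℝ)..Real.log x, ‖S c (ρ * Real.exp u) - S c (Real.exp u)‖ * Real.exp (-u)) + 4 * x + 3 := by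
  have hx0 : 0 < x := by linarith
  have hρ0 : 0 < ρ := by linarith
  have hxx : x ≤ ρ * x := le_mul_of_one_le_left hx0.le hρ
  set Y := ⌊x⌋₊ with hY
  set Y' := ⌊ρ * x⌋₊ with hY'
  have hY1 : 1 ≤ Y := Nat.le_floor (by simpa using hx)
  have hYY' : Y ≤ Y' := Nat.floor_le_floor hxx
  have hYx : (Y : ℝ) ≤ x := Nat.floor_le hx0.le
  have hY'x : (Y' : ℝ) ≤ ρ * x := Nat.floor_le (by positivity)
  set F : ℝ → ℝ := fun u => ‖S c (ρ * Real.exp u) - S c (Real.exp u)‖ * Real.exp (-u) with hF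
  set a : ℕ → ℝ := fun d => ‖S c (ρ * x / d) - S c (x / d)‖ with ha
  set κ : ℕ → ℝ := fun d => kk x d + kk (ρ * x) d with hκ
  -- Part 1: `d ≤ ⌊x⌋` via the per-`d` inequality
  -- the break points `e k = log(x/(Y+1-k))`
  set e : ℕ → ℝ := fun k => Real.log (x / ((Y + 1 - k : ℕ) : ℝ)) with he
  have he0 : e 0 = Real.log (x / (Y + 1)) := by simp [he]
  have heY : e Y = Real.log x := by
    simp only [he]; rw [show Y + 1 - Y = 1 by omega]; simp
  have hk : ∀ k ∈ Finset.range Y, a (Y - k) - κ (Y - k) ≤ x * ∫ u in e k..e (k + 1), F u := by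
    intro k hkY
    rw [Finset.mem_range] at hkY
    have h := norm_shortDiff_div_sub_kk_le hc hx0 hρ (d := Y - k) (by omega)
    have h1 : Real.log (x / (((Y - k : ℕ) : ℝ) + 1)) = e k := by
      simp only [he]; congr 2; rw [show Y + 1 - k = (Y - k) + 1 by omega]; push_cast; ring
    have h2 : Real.log (x / ((Y - k : ℕ) : ℝ)) = e (k + 1) := by
      simp only [he]; congr 2; rw [show Y + 1 - (k + 1) = Y - k by omega]
    rw [h1, h2] at h
    exact h
  have hsum := Finset.sum_le_sum hk
  rw [← Finset.mul_sum, intervalIntegral.sum_integral_adjacent_intervals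
    (fun k _ => intervalIntegrable_shortDiffExp hc hρ _ _), he0, heY] at hsum
  -- reindex the left-hand side
  have hreindex : ∑ k ∈ Finset.range Y, (a (Y - k) - κ (Y - k)) = ∑ d ∈ Finset.Icc 1 Y, (a d - κ d) := by
    have h1 := Finset.sum_range_reflect (fun k => a (k + 1) - κ (k + 1)) Y
    have h2 : ∀ k ∈ Finset.range Y, (a ((Y - 1 - k) + 1) - κ ((Y - 1 - k) + 1)) = (a (Y - k) - κ (Y - k)) := by
      intro k hkY
      rw [Finset.mem_range] at hkY
      rw [show Y - 1 - k + 1 = Y - k by omega]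
    rw [← Finset.sum_congr rfl h2, h1, show Finset.Icc 1 Y = Finset.Ico 1 (1 + Y) by
      ext d; simp only [Finset.mem_Icc, Finset.mem_Ico]; omega, Finset.sum_Ico_eq_sum_range,
      Nat.add_sub_cancel_left]
    refine Finset.sum_congr rfl fun k _ => ?_
    rw [add_comm 1 k]
  rw [hreindex, Finset.sum_sub_distrib] at hsum
  have hκsum : ∑ d ∈ Finset.Icc 1 Y, κ d ≤ Y + Y' := by
    simp only [hκ, Finset.sum_add_distrib]
    have e1 := sum_kk_le x Y
    have e2 := sum_kk_le (ρ * x) Y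
    rw [← hY] at e1; rw [← hY'] at e2
    linarith
  -- split the integral at `0`
  have hsplit : ∫ u in Real.log (x / (Y + 1))..Real.log x, F u =
      (∫ u in Real.log (x / (Y + 1))..0, F u) + ∫ u in (0:ℝ)..Real.log x, F u :=
    (intervalIntegral.integral_add_adjacent_intervals (intervalIntegrable_shortDiffExp hc hρ _ _)
      (intervalIntegrable_shortDiffExp hc hρ _ _)).symm
  have hneg : Real.log (x / (Y + 1)) ≤ 0 := by
    apply Real.log_nonpos (by positivity)
    rw [div_le_one (by positivity), hY]
    exact (Nat.lt_floor_add_one x).le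
  have hsmall : x * ∫ u in Real.log (x / (Y + 1))..0, F u ≤ 2 := by
    have hI : ∫ u in Real.log (x / (Y + 1))..0, F u ≤ ∫ u in Real.log (x / (Y + 1))..0, ρ :=
      intervalIntegral.integral_mono_on hneg (intervalIntegrable_shortDiffExp hc hρ _ _)
        intervalIntegrable_const (fun u _ => shortDiffExp_le hc hρ u)
    rw [intervalIntegral.integral_const, smul_eq_mul] at hI
    -- `0 - log(x/(Y+1)) = log((Y+1)/x) ≤ (Y+1)/x - 1 ≤ 1/x`
    have hlen : 0 - Real.log (x / (Y + 1)) ≤ 1 / x := by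
      rw [zero_sub, ← Real.log_inv, inv_div]
      have h1 := Real.log_le_sub_one_of_pos (show 0 < (Y + 1 : ℝ) / x by positivity)
      have h2 : ((Y : ℝ) + 1) / x - 1 ≤ 1 / x := by
        rw [div_sub_one hx0.ne', div_le_div_iff_of_pos_right hx0]; linarith
      linarith
    calc x * ∫ u in Real.log (x / (Y + 1))..0, F u ≤ x * ((0 - Real.log (x / (Y + 1))) * ρ) :=
          mul_le_mul_of_nonneg_left hI hx0.le
      _ ≤ x * (1 / x * ρ) := by gcongr
      _ = ρ := by field_simp
      _ ≤ 2 := hρ2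
  rw [hsplit, mul_add] at hsum
  -- Part 2: `⌊x⌋ < d ≤ ⌊ρx⌋`, each term `≤ 1`
  have hpart2 : ∑ d ∈ Finset.Ioc Y Y', a d ≤ Y' - Y := by
    have hterm : ∀ d ∈ Finset.Ioc Y Y', a d ≤ 1 := by
      intro d hd
      rw [Finset.mem_Ioc] at hd
      have hd0 : (0 : ℝ) < d := by exact_mod_cast (show 0 < d by omega)
      have hxd : x / d < 1 := by rw [div_lt_one hd0, hY] at *; exact Nat.lt_of_floor_lt hd.1
      simp only [ha]
      rw [S_of_lt_one c hxd, sub_zero]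
      refine (norm_S_le hc _).trans ?_
      have : ρ * x / d < 2 := by
        rw [div_lt_iff₀ hd0]
        have := Nat.lt_of_floor_lt hd.1
        nlinarith
      have hfl : ⌊ρ * x / d⌋₊ ≤ 1 := Nat.lt_succ_iff.mp ((Nat.floor_lt' (by norm_num)).2 (by exact_mod_cast this))
      exact_mod_cast hfl
    calc ∑ d ∈ Finset.Ioc Y Y', a d ≤ ∑ d ∈ Finset.Ioc Y Y', (1 : ℝ) := Finset.sum_le_sum hterm
      _ = Y' - Y := by rw [Finset.sum_const, Nat.card_Ioc, nsmul_eq_mul, Nat.cast_sub hYY']; ring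
  -- assemble: `Icc 1 Y' = Icc 1 Y ∪ Ioc Y Y'`
  have hunion : ∑ d ∈ Finset.Icc 1 Y', a d = ∑ d ∈ Finset.Icc 1 Y, a d + ∑ d ∈ Finset.Ioc Y Y', a d := by
    have e1 : Finset.Icc 1 Y' = Finset.Ioc 0 Y' := rfl
    have e2 : Finset.Icc 1 Y = Finset.Ioc 0 Y := rfl
    rw [e1, e2, ← Finset.sum_Ioc_consecutive _ (Nat.zero_le _) hYY']
  rw [hunion]
  have hY'le : (Y' : ℝ) ≤ 2 * x := hY'x.trans (by nlinarith)
  have : ∑ d ∈ Finset.Icc 1 Y, a d ≤ x * (∫ u in (0:ℝ)..Real.log x, F u) + (Y + Y') + 2 := by linarith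
  linarith

/-- **(A2) for the short difference of the restricted function, assembled**: if `C` is the constant of
`Halasz.exists_sum_abs_psi_sub_mul_kk_le`, then for a block system at level `N`, `g` completely multiplicative
with `|g| ≤ 1`, `∑_{p ∈ E} log p/p ≤ L`, `x ≥ 3`, `1 ≤ ρ ≤ 2`:
`‖S_a(ρx) - S_a(x)‖ log x ≤ x ∫_{log 2}^{log x} ‖S_a(ρe^u) - S_a(e^u)‖ e^{-u} du
   + (3C + 10 + 2L(ρ - 1)) x + |E| log(2x)`. [cite: GranvilleSoundararajan2003, Lemma 2.1, (2.1)] -/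
theorem norm_shortDiff_restr_mul_log_le_integral {C : ℝ}
    (hC : ∀ x : ℝ, 3 ≤ x → ∑ d ∈ Finset.Icc 1 ⌊x⌋₊, |Chebyshev.psi d - d| * kk x d ≤ C * x)
    [DecidableEq ι] (h : IsBlockSystem 𝓙 blk N) (hg : ∀ m n, g (m * n) = g m * g n)
    (hgb : ∀ n, ‖g n‖ ≤ 1) {L : ℝ} (hL : ∑ p ∈ 𝓙.biUnion blk, Real.log p / p ≤ L) {x ρ : ℝ} (hx : 3 ≤ x)
    (hρ : 1 ≤ ρ) (hρ2 : ρ ≤ 2) :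
    ‖S (restr 𝓙 blk g N) (ρ * x) - S (restr 𝓙 blk g N) x‖ * Real.log x ≤
      x * (∫ u in Real.log 2..Real.log x,
            ‖S (restr 𝓙 blk g N) (ρ * Real.exp u) - S (restr 𝓙 blk g N) (Real.exp u)‖ * Real.exp (-u)) +
        (3 * C + 10 + 2 * L * (ρ - 1)) * x + (𝓙.biUnion blk).card * Real.log (2 * x) := by
  set a := restr 𝓙 blk g N with ha
  have hab : ∀ n, ‖a n‖ ≤ 1 := norm_restr_le_one hgb
  have hx1 : 1 ≤ x := by linarith
  have hx0 : 0 < x := by linarith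
  have h1 := norm_shortDiff_restr_mul_log_le h hg hgb hL hx1 hρ
  have h2 := sum_vonMangoldt_mul_shortDiff_le hC hab hx hρ hρ2
  have h4 := sum_shortDiff_div_le hab hx1 hρ hρ2
  set F : ℝ → ℝ := fun u => ‖S a (ρ * Real.exp u) - S a (Real.exp u)‖ * Real.exp (-u) with hF
  have hsplit : ∫ u in (0:ℝ)..Real.log x, F u =
      (∫ u in (0:ℝ)..Real.log 2, F u) + ∫ u in Real.log 2..Real.log x, F u :=
    (intervalIntegral.integral_add_adjacent_intervals (intervalIntegrable_shortDiffExp hab hρ _ _)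
      (intervalIntegrable_shortDiffExp hab hρ _ _)).symm
  have hlog2 : 0 ≤ Real.log 2 := Real.log_nonneg (by norm_num)
  have hlog2' : Real.log 2 ≤ 0.7 := by have := Real.log_two_lt_d9; linarith
  have hsmall : ∫ u in (0:ℝ)..Real.log 2, F u ≤ 2 * 0.7 := by
    calc ∫ u in (0:ℝ)..Real.log 2, F u ≤ ∫ u in (0:ℝ)..Real.log 2, ρ :=
          intervalIntegral.integral_mono_on hlog2 (intervalIntegrable_shortDiffExp hab hρ _ _) intervalIntegrable_const
            (fun u _ => shortDiffExp_le hab hρ u)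
      _ = Real.log 2 * ρ := by simp
      _ ≤ 0.7 * 2 := by gcongr
      _ = 2 * 0.7 := by ring
  rw [hsplit] at h4
  -- the error terms of (A1)
  have hlogρ : Real.log ρ ≤ 0.7 := by
    calc Real.log ρ ≤ Real.log 2 := Real.log_le_log (by linarith) hρ2
      _ ≤ 0.7 := hlog2'
  have hlogρ0 : 0 ≤ Real.log ρ := Real.log_nonneg hρ
  have hE : ((𝓙.biUnion blk).card : ℝ) * Real.log (ρ * x) ≤ (𝓙.biUnion blk).card * Real.log (2 * x) := by
    gcongr
  have hlast : ((ρ - 1) * x + 1) * Real.log ρ ≤ x := by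
    have h0 : 0 ≤ (ρ - 1) * x + 1 := by nlinarith
    calc ((ρ - 1) * x + 1) * Real.log ρ ≤ (x + 1) * 0.7 := by
          apply mul_le_mul _ hlogρ hlogρ0 (by linarith); nlinarith
      _ ≤ x := by linarith
  have h5 : x * ∫ u in (0:ℝ)..Real.log 2, F u ≤ 2 * x := by nlinarith
  simp only [hF] at h4 h5 hsplit
  nlinarith [h1, h2, h4, h5, hE, hlast, mul_nonneg hx0.le hlogρ0]

/-! ### (A1) in logarithmic scale and the `α`-representation (GS03 (3.7)) -/

/-- `mulLog a N = a · log` for the (already truncated) restricted function `a`. [folklore] -/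
theorem psum_mulLog_restr (y : ℝ) :
    psum (mulLog (restr 𝓙 blk g N) N) y = psum (fun n => restr 𝓙 blk g N n * (Real.log n : ℂ)) y := by
  unfold psum
  exact Finset.sum_congr rfl fun n _ => mulLog_restr_apply n

/-- **(A1) in logarithmic coordinates for the short difference**: for `u > 0`, `1 ≤ ρ`,
`‖S_a(ρe^u) - S_a(e^u)‖ e^{-u} ≤ ‖A(ρe^u) - A(e^u)‖ e^{-u}/u + ((ρ-1)² + (ρ-1)e^{-u})/u`, `A = psum (a log)`.
[cite: GranvilleSoundararajan2003, §2 (proof of Lemma 2.1, first display)] -/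
theorem shortDiffExp_le_of_pos (hgb : ∀ n, ‖g n‖ ≤ 1) {ρ u : ℝ} (hρ : 1 ≤ ρ) (hu : 0 < u) :
    ‖S (restr 𝓙 blk g N) (ρ * Real.exp u) - S (restr 𝓙 blk g N) (Real.exp u)‖ * Real.exp (-u) ≤
      ‖psum (mulLog (restr 𝓙 blk g N) N) (ρ * Real.exp u) - psum (mulLog (restr 𝓙 blk g N) N) (Real.exp u)‖ *
          Real.exp (-u) / u + ((ρ - 1) ^ 2 + (ρ - 1) * Real.exp (-u)) / u := by
  set a := restr 𝓙 blk g N with ha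
  have hab : ∀ n, ‖a n‖ ≤ 1 := norm_restr_le_one hgb
  have h1 : (1 : ℝ) ≤ Real.exp u := by simpa using Real.one_le_exp hu.le
  have h := norm_shortDiff_mul_log_le_norm_sum hab h1 hρ
  rw [Real.log_exp, sum_Ioc_mul_log_eq_psum_sub a (Real.exp_pos u).le hρ, ← psum_mulLog_restr,
    ← psum_mulLog_restr] at h
  have hlogρ : Real.log ρ ≤ ρ - 1 := by
    have := Real.log_le_sub_one_of_pos (show 0 < ρ by linarith); linarith
  have hlogρ0 : 0 ≤ Real.log ρ := Real.log_nonneg hρ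
  rw [← add_div, le_div_iff₀ hu]
  have hee : Real.exp u * Real.exp (-u) = 1 := by rw [← Real.exp_add]; simp
  calc ‖S a (ρ * Real.exp u) - S a (Real.exp u)‖ * Real.exp (-u) * u
      = (‖S a (ρ * Real.exp u) - S a (Real.exp u)‖ * u) * Real.exp (-u) := by ring
    _ ≤ (‖psum (mulLog a N) (ρ * Real.exp u) - psum (mulLog a N) (Real.exp u)‖ +
          ((ρ - 1) * Real.exp u + 1) * Real.log ρ) * Real.exp (-u) := by gcongr
    _ ≤ (‖psum (mulLog a N) (ρ * Real.exp u) - psum (mulLog a N) (Real.exp u)‖ +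
          ((ρ - 1) * Real.exp u + 1) * (ρ - 1)) * Real.exp (-u) := by
        gcongr
    _ = ‖psum (mulLog a N) (ρ * Real.exp u) - psum (mulLog a N) (Real.exp u)‖ * Real.exp (-u) +
          ((ρ - 1) ^ 2 * (Real.exp u * Real.exp (-u)) + (ρ - 1) * Real.exp (-u)) := by ring
    _ = _ := by rw [hee, mul_one]

/-- The short-difference kernel `K(α, u) = ‖A(ρe^u) - A(e^u)‖ e^{-(1+2α)u}` is measurable on `ℝ × ℝ`. [folklore] -/
theorem measurable_shortKernel (c : ℕ → ℂ) (N : ℕ) (ρ : ℝ) :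
    Measurable fun p : ℝ × ℝ =>
      ‖psum (mulLog c N) (ρ * Real.exp p.2) - psum (mulLog c N) (Real.exp p.2)‖ * Real.exp (-((1 + 2 * p.1) * p.2)) := by
  refine Measurable.mul ?_ ?_
  · exact (((MellinPlancherel.measurable_psum _).comp ((Real.measurable_exp.comp measurable_snd).const_mul ρ)).sub
      ((MellinPlancherel.measurable_psum _).comp (Real.measurable_exp.comp measurable_snd))).norm
  · exact (Real.measurable_exp.comp (by fun_prop))

/-- On the rectangle `α ∈ (α₀, 1]`, `u ∈ (log 2, log x]` (`α₀ ≥ 0`, `x ≥ 1`, `1 ≤ ρ ≤ 2`), the short-difference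
kernel is bounded by `6 x (log x + 1)`. [folklore] -/
theorem shortKernel_le {c : ℕ → ℂ} (hc : ∀ n, ‖c n‖ ≤ 1) (N : ℕ) {x α₀ ρ : ℝ} (hx : 1 ≤ x) (hα₀ : 0 ≤ α₀)
    (hρ : 1 ≤ ρ) (hρ2 : ρ ≤ 2) {p : ℝ × ℝ} (hp : p ∈ Set.Ioc α₀ 1 ×ˢ Set.Ioc (Real.log 2) (Real.log x)) :
    ‖‖psum (mulLog c N) (ρ * Real.exp p.2) - psum (mulLog c N) (Real.exp p.2)‖ * Real.exp (-((1 + 2 * p.1) * p.2))‖ ≤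
      6 * x * (Real.log x + 1) := by
  obtain ⟨⟨hα1, -⟩, ⟨hu1, hu2⟩⟩ := hp
  have hlog2 : 0 < Real.log 2 := Real.log_pos (by norm_num)
  have hu0 : 0 < p.2 := hlog2.trans hu1
  have hx0 : 0 < x := by linarith
  have hexu : Real.exp p.2 ≤ x := by
    calc Real.exp p.2 ≤ Real.exp (Real.log x) := Real.exp_le_exp.2 hu2
      _ = x := Real.exp_log hx0
  have he1 : (1 : ℝ) ≤ Real.exp p.2 := by simpa using Real.one_le_exp hu0.le
  rw [Real.norm_of_nonneg (by positivity)]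
  have hlogx : 0 ≤ Real.log x := Real.log_nonneg hx
  have hA1 : ‖psum (mulLog c N) (Real.exp p.2)‖ ≤ x * Real.log x := by
    refine (norm_psum_mulLog_le_mul_log hc N he1).trans ?_
    rw [Real.log_exp]; gcongr
  have hA2 : ‖psum (mulLog c N) (ρ * Real.exp p.2)‖ ≤ 2 * x * (Real.log x + 1) := by
    have he2 : (1 : ℝ) ≤ ρ * Real.exp p.2 := by nlinarith
    refine (norm_psum_mulLog_le_mul_log hc N he2).trans ?_
    have hlog : Real.log (ρ * Real.exp p.2) ≤ Real.log x + 1 := by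
      rw [Real.log_mul (by linarith) (Real.exp_pos _).ne', Real.log_exp]
      have : Real.log ρ ≤ 1 := by
        calc Real.log ρ ≤ ρ - 1 := by have := Real.log_le_sub_one_of_pos (show 0 < ρ by linarith); linarith
          _ ≤ 1 := by linarith
      linarith
    have h0 : 0 ≤ Real.log (ρ * Real.exp p.2) := Real.log_nonneg he2
    calc ρ * Real.exp p.2 * Real.log (ρ * Real.exp p.2) ≤ (2 * x) * (Real.log x + 1) := by
          apply mul_le_mul _ hlog h0 (by positivity); nlinarith
      _ = 2 * x * (Real.log x + 1) := by ring
  have h2 : Real.exp (-((1 + 2 * p.1) * p.2)) ≤ 1 := by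
    rw [Real.exp_le_one_iff]
    have : 0 ≤ (1 + 2 * p.1) * p.2 := by
      have : 0 ≤ p.1 := hα₀.trans hα1.le
      positivity
    linarith
  calc ‖psum (mulLog c N) (ρ * Real.exp p.2) - psum (mulLog c N) (Real.exp p.2)‖ * Real.exp (-((1 + 2 * p.1) * p.2))
      ≤ (‖psum (mulLog c N) (ρ * Real.exp p.2)‖ + ‖psum (mulLog c N) (Real.exp p.2)‖) * 1 := by
        gcongr; exact norm_sub_le _ _
    _ ≤ (2 * x * (Real.log x + 1) + x * Real.log x) * 1 := by gcongr
    _ ≤ 6 * x * (Real.log x + 1) := by nlinarith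

/-- The short-difference kernel is integrable on the rectangle `(α₀, 1] × (log 2, log x]`. [folklore] -/
theorem integrable_shortKernel {c : ℕ → ℂ} (hc : ∀ n, ‖c n‖ ≤ 1) (N : ℕ) {x α₀ ρ : ℝ} (hx : 1 ≤ x)
    (hα₀ : 0 ≤ α₀) (hρ : 1 ≤ ρ) (hρ2 : ρ ≤ 2) :
    Integrable (fun p : ℝ × ℝ =>
        ‖psum (mulLog c N) (ρ * Real.exp p.2) - psum (mulLog c N) (Real.exp p.2)‖ * Real.exp (-((1 + 2 * p.1) * p.2)))
      ((volume.restrict (Set.Ioc α₀ 1)).prod (volume.restrict (Set.Ioc (Real.log 2) (Real.log x)))) := by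
  rw [Measure.prod_restrict, ← Measure.volume_eq_prod]
  refine Measure.integrableOn_of_bounded (M := 6 * x * (Real.log x + 1)) ?_
    (measurable_shortKernel c N ρ).aestronglyMeasurable ?_
  · rw [Measure.volume_eq_prod, Measure.prod_prod]
    exact ENNReal.mul_ne_top measure_Ioc_lt_top.ne measure_Ioc_lt_top.ne
  · exact ae_restrict_of_forall_mem (measurableSet_Ioc.prod measurableSet_Ioc)
      fun p hp => shortKernel_le hc N hx hα₀ hρ hρ2 hp

/-- **GS03 (3.7) for the short difference, one-sided**: for `x ≥ 3`, `1 ≤ ρ ≤ 2`, with `a = g̃ 1_𝒮` at level `N`,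
`A = psum (a log)` and `α₀ = 1/(2 log x)`,
`∫_{log 2}^{log x} ‖S_a(ρe^u) - S_a(e^u)‖ e^{-u} du ≤ 17 ∫_{α₀}^{1} (∫_{log 2}^{log x} ‖A(ρe^u) - A(e^u)‖ e^{-(1+2α)u} du) dα
  + ((ρ-1)² (log log x + 1) + (ρ-1))`. [cite: GranvilleSoundararajan2003, (3.7)] -/
theorem integral_shortDiffExp_le (hgb : ∀ n, ‖g n‖ ≤ 1) {x ρ : ℝ} (hx : 3 ≤ x) (hρ : 1 ≤ ρ) (hρ2 : ρ ≤ 2) :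
    ∫ u in Real.log 2..Real.log x,
        ‖S (restr 𝓙 blk g N) (ρ * Real.exp u) - S (restr 𝓙 blk g N) (Real.exp u)‖ * Real.exp (-u) ≤
      17 * (∫ α in Set.Ioc (1 / (2 * Real.log x)) 1,
              ∫ u in Set.Ioc (Real.log 2) (Real.log x),
                ‖psum (mulLog (restr 𝓙 blk g N) N) (ρ * Real.exp u) - psum (mulLog (restr 𝓙 blk g N) N) (Real.exp u)‖ *
                  Real.exp (-((1 + 2 * α) * u))) +
        ((ρ - 1) ^ 2 * (Real.log (Real.log x) + 1) + (ρ - 1)) := by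
  set a := restr 𝓙 blk g N with ha
  have hab : ∀ n, ‖a n‖ ≤ 1 := norm_restr_le_one hgb
  set δ : ℝ := ρ - 1 with hδ
  have hδ0 : 0 ≤ δ := by rw [hδ]; linarith
  set α₀ : ℝ := 1 / (2 * Real.log x) with hα₀
  set Sα : Set ℝ := Set.Ioc α₀ 1 with hSα
  set T : Set ℝ := Set.Ioc (Real.log 2) (Real.log x) with hT
  set K : ℝ → ℝ → ℝ := fun α u =>
    ‖psum (mulLog a N) (ρ * Real.exp u) - psum (mulLog a N) (Real.exp u)‖ * Real.exp (-((1 + 2 * α) * u)) with hK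
  set F : ℝ → ℝ := fun u => ‖S a (ρ * Real.exp u) - S a (Real.exp u)‖ * Real.exp (-u) with hF
  have hlog2 : (0.6931471803 : ℝ) < Real.log 2 := Real.log_two_gt_d9
  have hlog2' : Real.log 2 < 0.6931471808 := Real.log_two_lt_d9
  have hx1 : (1 : ℝ) ≤ x := by linarith
  have hlx : Real.log 2 ≤ Real.log x := Real.log_le_log (by norm_num) (by linarith)
  have hlx3 : 1 < Real.log x := by
    rw [← Real.log_exp 1]
    refine Real.log_lt_log (Real.exp_pos 1) ?_
    have := Real.exp_one_lt_d9
    linarith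
  have hα₀0 : 0 ≤ α₀ := by rw [hα₀]; positivity
  -- integrability of the kernel in both orders
  have hKint := integrable_shortKernel hab N hx1 hα₀0 hρ hρ2
  have hKint' : Integrable (Function.uncurry fun u α => K α u)
      ((volume.restrict T).prod (volume.restrict Sα)) := hKint.swap
  have hIu : Integrable (fun u => ∫ α in Sα, K α u) (volume.restrict T) := by
    have := hKint'.integral_prod_left
    simpa [Function.uncurry] using this
  -- pointwise bound on `T`
  have hpt : ∀ u ∈ Set.Icc (Real.log 2) (Real.log x),
      F u ≤ 17 * (∫ α in Sα, K α u) + (δ ^ 2 + δ * Real.exp (-u)) / u := by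
    intro u hu
    have hu0 : 0 < u := by linarith [hu.1]
    refine (shortDiffExp_le_of_pos hgb hρ hu0).trans ?_
    rw [← hδ]
    gcongr ?_ + _
    have hrep := inv_le_integral_exp (x := x) hu.1 hu.2
    have hA0 : 0 ≤ ‖psum (mulLog a N) (ρ * Real.exp u) - psum (mulLog a N) (Real.exp u)‖ * Real.exp (-u) := by
      positivity
    calc ‖psum (mulLog a N) (ρ * Real.exp u) - psum (mulLog a N) (Real.exp u)‖ * Real.exp (-u) / u
        = ‖psum (mulLog a N) (ρ * Real.exp u) - psum (mulLog a N) (Real.exp u)‖ * Real.exp (-u) * (1 / u) := by ring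
      _ ≤ ‖psum (mulLog a N) (ρ * Real.exp u) - psum (mulLog a N) (Real.exp u)‖ * Real.exp (-u) *
            (17 * ∫ α in (1 / (2 * Real.log x))..1, Real.exp (-(2 * α * u))) := by gcongr
      _ = 17 * ∫ α in α₀..1, ‖psum (mulLog a N) (ρ * Real.exp u) - psum (mulLog a N) (Real.exp u)‖ * Real.exp (-u) *
            Real.exp (-(2 * α * u)) := by
          rw [intervalIntegral.integral_const_mul]; ring
      _ = 17 * ∫ α in Sα, K α u := by
          rw [intervalIntegral.integral_of_le (by
            rw [hα₀]; rw [div_le_one (by positivity)]; linarith)]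
          congr 1
          refine setIntegral_congr_fun measurableSet_Ioc fun α _ => ?_
          simp only [hK]
          rw [mul_assoc, ← Real.exp_add]
          congr 2
          ring
  -- the elementary integral `∫ (δ² + δ e^{-u})/u ≤ δ² (log log x + 1) + δ`
  have hFint := intervalIntegrable_shortDiffExp hab hρ (Real.log 2) (Real.log x)
  have hinvInt : IntervalIntegrable (fun u : ℝ => 1 / u) volume (Real.log 2) (Real.log x) := by
    refine (continuousOn_const.div continuousOn_id fun u hu => ?_).intervalIntegrable
    rw [Set.uIcc_of_le hlx] at hu
    exact (ne_of_gt (by linarith [hu.1] : (0:ℝ) < u))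
  have hRcont : ContinuousOn (fun u : ℝ => (δ ^ 2 + δ * Real.exp (-u)) / u) (Set.uIcc (Real.log 2) (Real.log x)) := by
    refine ContinuousOn.div (by fun_prop) continuousOn_id fun u hu => ?_
    rw [Set.uIcc_of_le hlx] at hu
    exact (ne_of_gt (by linarith [hu.1] : (0:ℝ) < u))
  have hRint2 : IntervalIntegrable (fun u : ℝ => (δ ^ 2 + δ * Real.exp (-u)) / u) volume (Real.log 2) (Real.log x) :=
    hRcont.intervalIntegrable
  have hRint : IntervalIntegrable (fun u => 17 * (∫ α in Sα, K α u) + (δ ^ 2 + δ * Real.exp (-u)) / u) volume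
      (Real.log 2) (Real.log x) := by
    refine IntervalIntegrable.add ?_ hRint2
    rw [intervalIntegrable_iff_integrableOn_Ioc_of_le hlx]
    exact hIu.const_mul 17
  have helem : ∫ u in Real.log 2..Real.log x, (δ ^ 2 + δ * Real.exp (-u)) / u ≤ δ ^ 2 * (Real.log (Real.log x) + 1) + δ := by
    -- bound the integrand by `δ²/u + δ · (2 e^{-u})` (`1/u ≤ 1/log 2 ≤ 2`)
    have hpt2 : ∀ u ∈ Set.Icc (Real.log 2) (Real.log x), (δ ^ 2 + δ * Real.exp (-u)) / u ≤ δ ^ 2 * (1 / u) + δ * (2 * Real.exp (-u)) := by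
      intro u hu
      have hu0 : 0 < u := by linarith [hu.1]
      rw [add_div]
      gcongr ?_ + ?_
      · exact le_of_eq (by ring)
      · rw [mul_div_assoc]
        refine mul_le_mul_of_nonneg_left ?_ hδ0
        rw [div_le_iff₀ hu0]
        nlinarith [Real.exp_pos (-u), hu.1]
    have hI2 : IntervalIntegrable (fun u => δ ^ 2 * (1 / u) + δ * (2 * Real.exp (-u))) volume (Real.log 2) (Real.log x) :=
      (hinvInt.const_mul _).add ((by fun_prop : Continuous fun u : ℝ => 2 * Real.exp (-u)).intervalIntegrable _ _ |>.const_mul _)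
    calc ∫ u in Real.log 2..Real.log x, (δ ^ 2 + δ * Real.exp (-u)) / u
        ≤ ∫ u in Real.log 2..Real.log x, (δ ^ 2 * (1 / u) + δ * (2 * Real.exp (-u))) :=
          intervalIntegral.integral_mono_on hlx hRint2 hI2 hpt2
      _ = δ ^ 2 * (∫ u in Real.log 2..Real.log x, 1 / u) + δ * ∫ u in Real.log 2..Real.log x, 2 * Real.exp (-u) := by
          rw [intervalIntegral.integral_add (hinvInt.const_mul _)
            ((by fun_prop : Continuous fun u : ℝ => 2 * Real.exp (-u)).intervalIntegrable _ _ |>.const_mul _),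
            intervalIntegral.integral_const_mul, intervalIntegral.integral_const_mul]
      _ ≤ δ ^ 2 * (Real.log (Real.log x) + 1) + δ * 1 := by
          gcongr
          · rw [integral_one_div_of_pos (by linarith) (by linarith), Real.log_div (by linarith) (by linarith)]
            have : -1 ≤ Real.log (Real.log 2) := by
              rw [← Real.log_exp (-1)]
              refine Real.log_le_log (Real.exp_pos _) ?_
              rw [Real.exp_neg]
              have := Real.exp_one_gt_d9
              rw [inv_le_comm₀ (Real.exp_pos 1) (by linarith)]
              have h2 : (Real.log 2)⁻¹ ≤ 2 := by
                rw [inv_le_comm₀ (by linarith) (by norm_num)]; linarith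
              linarith
            linarith
          · rw [intervalIntegral.integral_const_mul, intervalIntegral.integral_comp_neg (fun u => Real.exp u),
              integral_exp]
            have e1 : Real.exp (-Real.log 2) = 1 / 2 := by
              rw [Real.exp_neg, Real.exp_log (by norm_num)]; norm_num
            rw [e1]
            have : 0 < Real.exp (-Real.log x) := Real.exp_pos _
            linarith
      _ = δ ^ 2 * (Real.log (Real.log x) + 1) + δ := by ring
  calc ∫ u in Real.log 2..Real.log x, F u
      ≤ ∫ u in Real.log 2..Real.log x, (17 * (∫ α in Sα, K α u) + (δ ^ 2 + δ * Real.exp (-u)) / u) :=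
        intervalIntegral.integral_mono_on hlx hFint hRint hpt
    _ = 17 * (∫ u in Real.log 2..Real.log x, ∫ α in Sα, K α u) +
          ∫ u in Real.log 2..Real.log x, (δ ^ 2 + δ * Real.exp (-u)) / u := by
        rw [intervalIntegral.integral_add ?_ hRint2, intervalIntegral.integral_const_mul]
        rw [intervalIntegrable_iff_integrableOn_Ioc_of_le hlx]
        exact hIu.const_mul 17
    _ ≤ 17 * (∫ α in Sα, ∫ u in T, K α u) + (δ ^ 2 * (Real.log (Real.log x) + 1) + δ) := by
        have hswap : (∫ u in Real.log 2..Real.log x, ∫ α in Sα, K α u) = ∫ α in Sα, ∫ u in T, K α u := by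
          rw [intervalIntegral.integral_of_le hlx]
          exact integral_integral_swap hKint'
        rw [hswap]
        linarith [helem]

/-! ### Prime and prime-power parts of the logarithmic pieces -/

section PrimeSplit

variable {c : ℕ → ℂ} {s : ℂ}

/-- Domination gives summability of an `L`-series. [folklore] -/
theorem lseriesSummable_of_norm_le {f : ℕ → ℂ} (hle : ∀ n, ‖f n‖ ≤ ‖c n‖) (hc : LSeriesSummable c s) :
    LSeriesSummable f s := by
  refine Summable.of_norm_bounded hc.norm fun n => ?_
  rcases Nat.eq_zero_or_pos n with rfl | hn
  · simp [LSeries.term_zero]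
  · rw [LSeries.term_of_ne_zero hn.ne', LSeries.term_of_ne_zero hn.ne', norm_div, norm_div]
    gcongr
    exact hle n

/-- `L_c = L_{c 1_primes} + L_{c 1_{non-primes}}`. [folklore] -/
theorem LSeries_eq_prime_add_pow (hc : LSeriesSummable c s) :
    LSeries c s = LSeries (fun n => if n.Prime then c n else 0) s + LSeries (fun n => if n.Prime then 0 else c n) s := by
  have h1 : LSeriesSummable (fun n => if n.Prime then c n else 0) s :=
    lseriesSummable_of_norm_le (fun n => by split_ifs <;> simp) hc
  have h2 : LSeriesSummable (fun n => if n.Prime then 0 else c n) s :=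
    lseriesSummable_of_norm_le (fun n => by split_ifs <;> simp) hc
  rw [← LSeries_add h1 h2]
  congr 1
  funext n
  simp only [Pi.add_apply]
  split_ifs <;> simp

/-- For `‖c(n)‖ ≤ Λ(n)`: the prime part satisfies `‖·‖ ≤ log n` on primes, `0` elsewhere. [folklore] -/
theorem norm_primePart_le (hc : ∀ n, ‖c n‖ ≤ vonMangoldt n) (n : ℕ) :
    ‖(if n.Prime then c n else 0)‖ ≤ if n.Prime then Real.log n else 0 := by
  split_ifs with hp
  · refine (hc n).trans (le_of_eq ?_)
    rw [ArithmeticFunction.vonMangoldt_apply_prime hp]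
  · simp

/-- For `‖c(n)‖ ≤ Λ(n)`: the prime-power part satisfies `‖·‖ ≤ Λ(n)` off the primes, `0` on primes. [folklore] -/
theorem norm_powPart_le (hc : ∀ n, ‖c n‖ ≤ vonMangoldt n) (n : ℕ) :
    ‖(if n.Prime then 0 else c n)‖ ≤ if n.Prime then 0 else (vonMangoldt n : ℝ) := by
  split_ifs with hp
  · simp
  · exact hc n

/-- For `‖c(n)‖ ≤ Λ(n)` and `Re s > 1`: `‖L_c(s)‖ ≤ ‖L_{c 1_primes}(s)‖ + 2`. [folklore] -/
theorem norm_LSeries_le_primePart_add_two (hc : ∀ n, ‖c n‖ ≤ vonMangoldt n) (hs : 1 < s.re) :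
    ‖LSeries c s‖ ≤ ‖LSeries (fun n => if n.Prime then c n else 0) s‖ + 2 := by
  have hsumm : LSeriesSummable c s := by
    refine lseriesSummable_of_norm_le (c := fun n => (vonMangoldt n : ℂ)) (fun n => ?_) ?_
    · rw [Complex.norm_real, Real.norm_of_nonneg ArithmeticFunction.vonMangoldt_nonneg]; exact hc n
    · exact ArithmeticFunction.LSeriesSummable_vonMangoldt hs
  rw [LSeries_eq_prime_add_pow hsumm]
  refine (norm_add_le _ _).trans ?_
  gcongr
  exact MellinPlancherel.norm_LSeries_primePow_le (norm_powPart_le hc) hs.le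

end PrimeSplit

/-- The prime part of a block piece lives on the block: if `(c 1_primes)(n) ≠ 0` with `c = g̃Λ1_{blk}` then
`n ∈ blk`, so `n ≤ Q` when the block consists of primes `≤ Q`. [folklore] -/
theorem primePart_vmIn_support {P : Finset ℕ} (hP : ∀ p ∈ P, p.Prime) {Q : ℝ}
    (hPQ : ∀ p ∈ P, (p : ℝ) ≤ Q) (n : ℕ) (hn : (if n.Prime then vmIn P g N n else 0) ≠ 0) : (n : ℝ) ≤ Q := by
  by_cases hp : n.Prime
  · rw [if_pos hp] at hn
    have hex : ∃ p ∈ P, p ∣ n := by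
      by_contra hno
      push Not at hno
      exact hn (vmIn_eq_zero_of_forall P hno)
    obtain ⟨p, hpP, hpn⟩ := hex
    have : p = n := ((Nat.prime_dvd_prime_iff_eq (hP p hpP) hp).1 hpn)
    subst this
    exact hPQ p hpP
  · rw [if_neg hp] at hn; exact absurd rfl hn

/-! ### The window: pointwise bound for `D_a = P_∁ 𝒢_a + ∑ P_i 𝒢_{a_i}` with the prime parts -/

/-- **Pointwise in the window.**  If `‖𝒢_a(s)‖ ≤ B` and `‖𝒢_{a_i}(s)‖ ≤ B'` for all `i` (`Re s > 1`, `B ≤ B'`), then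
`‖D_a(s)‖² ≤ 2B² ‖P_∁^{pr}(s)‖² + 4B'²|𝓙| ∑_i ‖P_i^{pr}(s)‖² + 16 B'² (|𝓙| + 1)²`,
where `P^{pr}` are the prime parts of the logarithmic pieces (the prime-power parts are bounded by `2`).  Only the
first term — the main term — carries `B`; in the application `B` is a refined Euler-product bound and `B'` the crude
`e^{12}/α`. [folklore] -/
theorem norm_mulLog_restr_sq_le_prime [DecidableEq ι] (h : IsBlockSystem 𝓙 blk N)
    (hg : ∀ m n, g (m * n) = g m * g n) (hg1 : g 1 = 1) (hgb : ∀ n, ‖g n‖ ≤ 1) {s : ℂ}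
    (hs : 1 < s.re) {B B' : ℝ} (hBB' : B ≤ B') (hB : ‖LSeries (restr 𝓙 blk g N) s‖ ≤ B)
    (hBi : ∀ i ∈ 𝓙, ‖LSeries (restr (𝓙.erase i) blk g N) s‖ ≤ B') :
    ‖LSeries (mulLog (restr 𝓙 blk g N) N) s‖ ^ 2 ≤
      2 * B ^ 2 * ‖LSeries (fun n => if n.Prime then mulVM (sieveOut (𝓙.biUnion blk) g) N n else 0) s‖ ^ 2 +
        4 * B' ^ 2 * 𝓙.card * ∑ i ∈ 𝓙, ‖LSeries (fun n => if n.Prime then vmIn (blk i) g N n else 0) s‖ ^ 2 +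
        16 * B' ^ 2 * (𝓙.card + 1) ^ 2 := by
  set f₀ : ℝ := ‖LSeries (fun n => if n.Prime then mulVM (sieveOut (𝓙.biUnion blk) g) N n else 0) s‖ with hf₀
  set f : ι → ℝ := fun i => ‖LSeries (fun n => if n.Prime then vmIn (blk i) g N n else 0) s‖ with hf
  have hD := LSeries_mulLog_restr_eq h hg hg1 hgb hs
  have hB0 : 0 ≤ B := (norm_nonneg _).trans hB
  -- the pieces
  have hc₀ : ∀ n, ‖mulVM (sieveOut (𝓙.biUnion blk) g) N n‖ ≤ vonMangoldt n :=
    fun n => norm_mulVM_le (norm_sieveOut_le hgb _) n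
  have hci : ∀ i, ∀ n, ‖vmIn (blk i) g N n‖ ≤ vonMangoldt n := fun i n => norm_vmIn_le hgb _ n
  have hP₀ := norm_LSeries_le_primePart_add_two hc₀ hs
  have hPi : ∀ i, ‖LSeries (vmIn (blk i) g N) s‖ ≤ f i + 2 := fun i => norm_LSeries_le_primePart_add_two (hci i) hs
  -- `‖D‖ ≤ B (f₀ + 2) + B' ∑ (f i + 2) ≤ B f₀ + B' (∑ f i + 2(J+1))`
  have hnorm : ‖LSeries (mulLog (restr 𝓙 blk g N) N) s‖ ≤ B * f₀ + B' * (∑ i ∈ 𝓙, f i + 2 * (𝓙.card + 1)) := by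
    rw [hD]
    refine (norm_add_le _ _).trans ?_
    have e1 : ‖LSeries (mulVM (sieveOut (𝓙.biUnion blk) g) N) s * LSeries (restr 𝓙 blk g N) s‖ ≤ (f₀ + 2) * B := by
      rw [norm_mul]; exact mul_le_mul hP₀ hB (norm_nonneg _) (by positivity)
    have e2 : ‖∑ i ∈ 𝓙, LSeries (vmIn (blk i) g N) s * LSeries (restr (𝓙.erase i) blk g N) s‖ ≤
        ∑ i ∈ 𝓙, (f i + 2) * B' := by
      refine (norm_sum_le _ _).trans (Finset.sum_le_sum fun i hi => ?_)
      rw [norm_mul]; exact mul_le_mul (hPi i) (hBi i hi) (norm_nonneg _) (by positivity)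
    rw [← Finset.sum_mul, Finset.sum_add_distrib, Finset.sum_const, nsmul_eq_mul] at e2
    have e3 : (f₀ + 2) * B + (∑ i ∈ 𝓙, f i + (𝓙.card : ℝ) * 2) * B' ≤ B * f₀ + B' * (∑ i ∈ 𝓙, f i + 2 * (𝓙.card + 1)) := by
      linarith
    linarith [e1, e2, e3]
  -- square
  set Sf : ℝ := ∑ i ∈ 𝓙, f i with hSf
  set cJ : ℝ := 2 * ((𝓙.card : ℝ) + 1) with hcJ
  set Q₂ : ℝ := (𝓙.card : ℝ) * ∑ i ∈ 𝓙, f i ^ 2 with hQ₂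
  have h1 : Sf ^ 2 ≤ Q₂ := by rw [hSf, hQ₂]; exact sq_sum_le 𝓙 f
  have hR1 : (Sf + cJ) ^ 2 ≤ 2 * Sf ^ 2 + 2 * cJ ^ 2 := by nlinarith [sq_nonneg (Sf - cJ)]
  have hR : (Sf + cJ) ^ 2 ≤ 2 * Q₂ + 2 * cJ ^ 2 := by linarith
  have hD0 : 0 ≤ ‖LSeries (mulLog (restr 𝓙 blk g N) N) s‖ := norm_nonneg _
  have hsq1 : ‖LSeries (mulLog (restr 𝓙 blk g N) N) s‖ ^ 2 ≤ (B * f₀ + B' * (Sf + cJ)) ^ 2 :=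
    pow_le_pow_left₀ hD0 hnorm 2
  have hsq2 : (B * f₀ + B' * (Sf + cJ)) ^ 2 ≤ 2 * (B * f₀) ^ 2 + 2 * (B' * (Sf + cJ)) ^ 2 := by
    nlinarith [sq_nonneg (B * f₀ - B' * (Sf + cJ))]
  have hB2 : 0 ≤ B' ^ 2 := sq_nonneg B'
  have hsq3 : 2 * (B' * (Sf + cJ)) ^ 2 ≤ 2 * B' ^ 2 * (2 * Q₂ + 2 * cJ ^ 2) := by
    have : (B' * (Sf + cJ)) ^ 2 = B' ^ 2 * (Sf + cJ) ^ 2 := by ring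
    rw [this]
    nlinarith [mul_le_mul_of_nonneg_left hR hB2]
  have hfin : 2 * (B * f₀) ^ 2 + 2 * B' ^ 2 * (2 * Q₂ + 2 * cJ ^ 2) =
      2 * B ^ 2 * f₀ ^ 2 + 4 * B' ^ 2 * 𝓙.card * ∑ i ∈ 𝓙, f i ^ 2 + 16 * B' ^ 2 * (𝓙.card + 1) ^ 2 := by
    rw [hQ₂, hcJ]; ring
  linarith [hsq1, hsq2, hsq3, hfin]

/-! ### The mean square of the short difference of `A` -/

/-- `∫_ℝ dy/|1+α+iy|² ≤ π` (`α ≥ 0`). [folklore] -/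
theorem integral_inv_normSq_line_le {α : ℝ} (hα : 0 ≤ α) :
    Integrable (fun y : ℝ => 1 / ‖(1 : ℂ) + α + y * I‖ ^ 2) ∧ ∫ y : ℝ, 1 / ‖(1 : ℂ) + α + y * I‖ ^ 2 ≤ π := by
  have hden : ∀ y : ℝ, 1 + y ^ 2 ≤ ‖(1 : ℂ) + α + y * I‖ ^ 2 := by
    intro y
    rw [Complex.sq_norm, Complex.normSq_apply]
    simp
    nlinarith
  have hle : ∀ y : ℝ, 1 / ‖(1 : ℂ) + α + y * I‖ ^ 2 ≤ (1 + y ^ 2)⁻¹ := by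
    intro y
    rw [one_div]
    exact inv_anti₀ (by positivity) (hden y)
  have hmeas : AEStronglyMeasurable (fun y : ℝ => 1 / ‖(1 : ℂ) + α + y * I‖ ^ 2) volume := by
    refine (Continuous.aestronglyMeasurable ?_)
    refine continuous_const.div ((Continuous.norm (by fun_prop)).pow 2) fun y => ?_
    have : ((1 : ℂ) + α + y * I) ≠ 0 := by
      intro h
      have := congrArg Complex.re h
      simp at this
      linarith
    positivity
  have hint : Integrable (fun y : ℝ => 1 / ‖(1 : ℂ) + α + y * I‖ ^ 2) :=
    Integrable.mono' integrable_inv_one_add_sq hmeas (Filter.Eventually.of_forall fun y => by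
      rw [Real.norm_of_nonneg (by positivity)]; exact hle y)
  refine ⟨hint, ?_⟩
  calc ∫ y : ℝ, 1 / ‖(1 : ℂ) + α + y * I‖ ^ 2 ≤ ∫ y : ℝ, (1 + y ^ 2)⁻¹ :=
        integral_mono hint integrable_inv_one_add_sq hle
    _ = π := integral_univ_inv_one_add_sq

/-- Continuity of the multiplier `y ↦ ‖ρ^{1+α+iy} - 1‖²` (`ρ > 0`). [folklore] -/
theorem continuous_mult {ρ α : ℝ} (hρ : 0 < ρ) :
    Continuous fun y : ℝ => ‖(ρ : ℂ) ^ ((1 : ℂ) + α + y * I) - 1‖ ^ 2 := by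
  refine (Continuous.norm ?_).pow 2
  refine Continuous.sub ?_ continuous_const
  exact Continuous.const_cpow (by fun_prop) (Or.inl (by exact_mod_cast hρ.ne'))

/-- The multiplier is at most `25` for `1 ≤ ρ ≤ 2` on `Re s = 1 + α`, `α ≤ 1`. [folklore] -/
theorem mult_le {ρ α : ℝ} (hρ1 : 1 ≤ ρ) (hρ2 : ρ ≤ 2) (hα1 : α ≤ 1) (y : ℝ) :
    ‖(ρ : ℂ) ^ ((1 : ℂ) + α + y * I) - 1‖ ^ 2 ≤ 25 := by
  have := MellinPlancherel.norm_cpow_sub_one_le_five hρ1 hρ2 (s := (1 : ℂ) + α + y * I) (by simp; linarith)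
  nlinarith [norm_nonneg ((ρ : ℂ) ^ ((1 : ℂ) + α + y * I) - 1)]

/-- The multiplier-weighted square of a prime-part series is integrable in `y`. [folklore] -/
theorem integrable_mult_normSq_primePart {c : ℕ → ℂ} (hc : ∀ n, ‖c n‖ ≤ vonMangoldt n) {ρ α : ℝ} (hρ1 : 1 ≤ ρ)
    (hρ2 : ρ ≤ 2) (hα : 0 < α) (hα1 : α ≤ 1) :
    Integrable fun y : ℝ => ‖(ρ : ℂ) ^ ((1 : ℂ) + α + y * I) - 1‖ ^ 2 *
      (‖LSeries (fun n => if n.Prime then c n else 0) (1 + α + y * I)‖ ^ 2 / ‖(1 : ℂ) + α + y * I‖ ^ 2) := by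
  have hs := MellinPlancherel.summable_norm_div_rpow_of_primeLogBound (norm_primePart_le hc) (σ' := 1 + α) (by linarith)
  have hint := integrable_norm_LSeries_sq_div (a := fun n => if n.Prime then c n else 0) (σ := 1 + α) (by linarith) hs
  simp only [ofReal_one_add] at hint
  refine hint.bdd_mul (c := 25) (continuous_mult (by linarith)).aestronglyMeasurable
    (Filter.Eventually.of_forall fun y => ?_)
  rw [Real.norm_of_nonneg (by positivity)]
  exact mult_le hρ1 hρ2 hα1 y

/-- **The window for the short difference** (substitute for GS03 (3.12)): if `‖𝒢_a(1+α+iy)‖ ≤ B` and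
`‖𝒢_{a_i}(1+α+iy)‖ ≤ B` for `|y| ≤ T'` and all `i`, then, with the multiplier `w(y) = ‖ρ^s - 1‖²`,
`∫_{|y|≤T'} w |D_a/s|² ≤ 2B² ∫_ℝ w |P_∁^{pr}/s|² + 4B²|𝓙| ∑_i ∫_ℝ w |P_i^{pr}/s|² + 400 B² (|𝓙|+1)² ∫_ℝ |1/s|²`. [folklore] -/
theorem setIntegral_window_short_le [DecidableEq ι] (h : IsBlockSystem 𝓙 blk N)
    (hg : ∀ m n, g (m * n) = g m * g n) (hg1 : g 1 = 1) (hgb : ∀ n, ‖g n‖ ≤ 1) {α : ℝ} (hα : 0 < α) (hα1 : α ≤ 1)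
    {ρ : ℝ} (hρ1 : 1 ≤ ρ) (hρ2 : ρ ≤ 2) {T' B B' : ℝ} (hBB' : B ≤ B')
    (hB : ∀ y : ℝ, |y| ≤ T' → ‖LSeries (restr 𝓙 blk g N) (1 + α + y * I)‖ ≤ B)
    (hBi : ∀ i ∈ 𝓙, ∀ y : ℝ, |y| ≤ T' → ‖LSeries (restr (𝓙.erase i) blk g N) (1 + α + y * I)‖ ≤ B') :
    ∫ y in Set.Icc (-T') T', ‖(ρ : ℂ) ^ ((1 : ℂ) + α + y * I) - 1‖ ^ 2 *
        (‖LSeries (mulLog (restr 𝓙 blk g N) N) (1 + α + y * I)‖ ^ 2 / ‖(1 : ℂ) + α + y * I‖ ^ 2) ≤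
      2 * B ^ 2 * (∫ y : ℝ, ‖(ρ : ℂ) ^ ((1 : ℂ) + α + y * I) - 1‖ ^ 2 *
          (‖LSeries (fun n => if n.Prime then mulVM (sieveOut (𝓙.biUnion blk) g) N n else 0) (1 + α + y * I)‖ ^ 2 /
            ‖(1 : ℂ) + α + y * I‖ ^ 2)) +
        4 * B' ^ 2 * 𝓙.card * (∑ i ∈ 𝓙, ∫ y : ℝ, ‖(ρ : ℂ) ^ ((1 : ℂ) + α + y * I) - 1‖ ^ 2 *
          (‖LSeries (fun n => if n.Prime then vmIn (blk i) g N n else 0) (1 + α + y * I)‖ ^ 2 /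
            ‖(1 : ℂ) + α + y * I‖ ^ 2)) +
        400 * B' ^ 2 * (𝓙.card + 1) ^ 2 * ∫ y : ℝ, 1 / ‖(1 : ℂ) + α + y * I‖ ^ 2 := by
  set w : ℝ → ℝ := fun y => ‖(ρ : ℂ) ^ ((1 : ℂ) + α + y * I) - 1‖ ^ 2 with hwdef
  set F₀ : ℝ → ℝ := fun y => w y *
    (‖LSeries (fun n => if n.Prime then mulVM (sieveOut (𝓙.biUnion blk) g) N n else 0) (1 + α + y * I)‖ ^ 2 /
      ‖(1 : ℂ) + α + y * I‖ ^ 2) with hF₀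
  set F : ι → ℝ → ℝ := fun i y => w y *
    (‖LSeries (fun n => if n.Prime then vmIn (blk i) g N n else 0) (1 + α + y * I)‖ ^ 2 /
      ‖(1 : ℂ) + α + y * I‖ ^ 2) with hF
  set F₁ : ℝ → ℝ := fun y => 1 / ‖(1 : ℂ) + α + y * I‖ ^ 2 with hF₁
  have hw5 : ∀ y, w y ≤ 25 := fun y => mult_le hρ1 hρ2 hα1 y
  have hw0 : ∀ y, 0 ≤ w y := fun y => by positivity
  have hc₀ : ∀ n, ‖mulVM (sieveOut (𝓙.biUnion blk) g) N n‖ ≤ vonMangoldt n :=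
    fun n => norm_mulVM_le (norm_sieveOut_le hgb _) n
  have hci : ∀ i, ∀ n, ‖vmIn (blk i) g N n‖ ≤ vonMangoldt n := fun i n => norm_vmIn_le hgb _ n
  have hF₀int : Integrable F₀ := integrable_mult_normSq_primePart hc₀ hρ1 hρ2 hα hα1
  have hFint : ∀ i ∈ 𝓙, Integrable (F i) := fun i _ => integrable_mult_normSq_primePart (hci i) hρ1 hρ2 hα hα1
  obtain ⟨hF₁int, -⟩ := integral_inv_normSq_line_le hα.le
  have hDint := integrable_normSq_mulLog_div (g := restr 𝓙 blk g N) (N := N) (norm_restr_le_one hgb) hα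
  have hGint : Integrable fun y : ℝ => w y *
      (‖LSeries (mulLog (restr 𝓙 blk g N) N) (1 + α + y * I)‖ ^ 2 / ‖(1 : ℂ) + α + y * I‖ ^ 2) := by
    refine hDint.bdd_mul (c := 25) (continuous_mult (by linarith)).aestronglyMeasurable
      (Filter.Eventually.of_forall fun y => ?_)
    rw [Real.norm_of_nonneg (hw0 y)]; exact hw5 y
  set R : ℝ → ℝ := fun y => 2 * B ^ 2 * F₀ y + 4 * B' ^ 2 * 𝓙.card * ∑ i ∈ 𝓙, F i y +
    400 * B' ^ 2 * (𝓙.card + 1) ^ 2 * F₁ y with hR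
  have hRint : Integrable R := by
    refine Integrable.add (Integrable.add (hF₀int.const_mul _) ?_) (hF₁int.const_mul _)
    exact (integrable_finsetSum 𝓙 hFint).const_mul _
  have hR0 : 0 ≤ᵐ[volume] R := Filter.Eventually.of_forall fun y => by
    simp only [hR, hF₀, hF, hF₁]
    have : 0 ≤ ∑ i ∈ 𝓙, w y * (‖LSeries (fun n => if n.Prime then vmIn (blk i) g N n else 0) (1 + ↑α + ↑y * I)‖ ^ 2 /
        ‖(1 : ℂ) + ↑α + ↑y * I‖ ^ 2) := Finset.sum_nonneg fun i _ => mul_nonneg (hw0 y) (by positivity)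
    have := hw0 y
    positivity
  calc ∫ y in Set.Icc (-T') T', w y * (‖LSeries (mulLog (restr 𝓙 blk g N) N) (1 + α + y * I)‖ ^ 2 / ‖(1 : ℂ) + α + y * I‖ ^ 2)
      ≤ ∫ y in Set.Icc (-T') T', R y := by
        refine setIntegral_mono_on hGint.integrableOn hRint.integrableOn measurableSet_Icc fun y hy => ?_
        have hyT : |y| ≤ T' := abs_le.2 ⟨by linarith [hy.1], hy.2⟩
        have hsre : 1 < ((1 : ℂ) + α + y * I).re := by simp; linarith
        have hpt := norm_mulLog_restr_sq_le_prime h hg hg1 hgb hsre hBB' (hB y hyT) (fun i hi => hBi i hi y hyT)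
        have hspos : 0 < ‖(1 : ℂ) + α + y * I‖ ^ 2 := by
          have : ((1 : ℂ) + α + y * I) ≠ 0 := by
            intro h0; have := congrArg Complex.re h0; simp at this; linarith
          positivity
        -- multiply `hpt` by the nonnegative factor `w y / ‖s‖²`
        have hmul := mul_le_mul_of_nonneg_left hpt (div_nonneg (hw0 y) hspos.le)
        have hw25 : w y / ‖(1 : ℂ) + α + y * I‖ ^ 2 ≤ 25 * F₁ y := by
          simp only [hF₁]
          rw [mul_one_div]; exact div_le_div_of_nonneg_right (hw5 y) hspos.le
        have hB16 : 0 ≤ 16 * B' ^ 2 * ((𝓙.card : ℝ) + 1) ^ 2 := by positivity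
        have key : w y / ‖(1 : ℂ) + α + y * I‖ ^ 2 *
            (2 * B ^ 2 * ‖LSeries (fun n => if n.Prime then mulVM (sieveOut (𝓙.biUnion blk) g) N n else 0) (1 + α + y * I)‖ ^ 2 +
              4 * B' ^ 2 * 𝓙.card * ∑ i ∈ 𝓙, ‖LSeries (fun n => if n.Prime then vmIn (blk i) g N n else 0) (1 + α + y * I)‖ ^ 2 +
              16 * B' ^ 2 * (𝓙.card + 1) ^ 2) =
            2 * B ^ 2 * F₀ y + 4 * B' ^ 2 * 𝓙.card * ∑ i ∈ 𝓙, F i y +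
              (w y / ‖(1 : ℂ) + α + y * I‖ ^ 2) * (16 * B' ^ 2 * (𝓙.card + 1) ^ 2) := by
          simp only [hF₀, hF, Finset.mul_sum]
          have e0 : ∀ X : ℝ, w y / ‖(1 : ℂ) + α + y * I‖ ^ 2 * X = w y * (X / ‖(1 : ℂ) + α + y * I‖ ^ 2) := fun X => by ring
          rw [mul_add, mul_add, Finset.mul_sum]
          congr 1
          congr 1
          · rw [← e0]; ring
          · refine Finset.sum_congr rfl fun i _ => ?_
            rw [← mul_assoc, mul_comm (w y / ‖(1 : ℂ) + α + y * I‖ ^ 2), mul_assoc, e0]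
        have hlast : (w y / ‖(1 : ℂ) + α + y * I‖ ^ 2) * (16 * B' ^ 2 * (𝓙.card + 1) ^ 2) ≤
            400 * B' ^ 2 * (𝓙.card + 1) ^ 2 * F₁ y := by nlinarith [hw25, hB16]
        have hLHS : w y * (‖LSeries (mulLog (restr 𝓙 blk g N) N) (1 + α + y * I)‖ ^ 2 / ‖(1 : ℂ) + α + y * I‖ ^ 2) =
            w y / ‖(1 : ℂ) + α + y * I‖ ^ 2 * ‖LSeries (mulLog (restr 𝓙 blk g N) N) (1 + α + y * I)‖ ^ 2 := by ring
        rw [hLHS]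
        simp only [hR]
        linarith [hmul, key, hlast]
    _ ≤ ∫ y, R y := setIntegral_le_integral hRint hR0
    _ = 2 * B ^ 2 * (∫ y, F₀ y) + 4 * B' ^ 2 * 𝓙.card * (∑ i ∈ 𝓙, (∫ y, F i y)) +
          400 * B' ^ 2 * (𝓙.card + 1) ^ 2 * ∫ y, F₁ y := by
        simp only [hR]
        rw [integral_add (f := fun y => 2 * B ^ 2 * F₀ y + 4 * B' ^ 2 * 𝓙.card * ∑ i ∈ 𝓙, F i y)
            (g := fun y => 400 * B' ^ 2 * (𝓙.card + 1) ^ 2 * F₁ y)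
            ((hF₀int.const_mul _).add ((integrable_finsetSum 𝓙 hFint).const_mul _)) (hF₁int.const_mul _),
          integral_add (f := fun y => 2 * B ^ 2 * F₀ y) (g := fun y => 4 * B' ^ 2 * 𝓙.card * ∑ i ∈ 𝓙, F i y)
            (hF₀int.const_mul _) ((integrable_finsetSum 𝓙 hFint).const_mul _),
          integral_const_mul, integral_const_mul, integral_const_mul, integral_finsetSum 𝓙 hFint]

/-- **The mean square of the short difference of `A = ∑ a log`** (the substitute for GS03 Lemma 3.2).
Let `a = g̃ 1_𝒮` for a block system of primes `≤ Q` (`Q ≥ 1`) at level `N`, `0 < α ≤ 1`, `0 < δ ≤ 1`,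
`ρ = 1 + δ`, `T' ≥ 1`, `u₀ ≥ 0` with `θ(ρy) - θ(y) ≤ 2δy` for `y ≥ e^{u₀}`; suppose
`‖𝒢_a(1+α+iy)‖ ≤ B` and `‖𝒢_{a_i}(1+α+iy)‖ ≤ B'` for `|y| ≤ T'` and all `i` (`B ≤ B'`).  Then, with `J = |𝓙|`,
`W₀ = (u₀+1)²(2δ²u₀+1)`,
`∫_ℝ ‖A(ρe^u) - A(e^u)‖² e^{-2(1+α)u} du
   ≤ B² · 4δ²/α + B'² (16 J² δ² log Q + (2 + 4J²) W₀ + 200 (J+1)²) + (25/π)(240/T' + (1920 + 520e^{10}/α³)/T'²)`: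
the MAIN term `4B²δ²/α` carries the refined bound `B` and the interval length `δ` (the mean value theorem would give
`δ²/α²` here), everything else is secondary.
[cite: GranvilleSoundararajan2003, Lemma 3.2] -/
theorem meanSquare_shortDiff_mulLog_restr_le [DecidableEq ι] (h : IsBlockSystem 𝓙 blk N)
    (hg : ∀ m n, g (m * n) = g m * g n) (hg1 : g 1 = 1) (hgb : ∀ n, ‖g n‖ ≤ 1)
    {α : ℝ} (hα : 0 < α) (hα1 : α ≤ 1) {δ : ℝ} (hδ0 : 0 < δ) (hδ1 : δ ≤ 1) {T' : ℝ} (hT' : 1 ≤ T')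
    {Q : ℝ} (hQ : 1 ≤ Q) (hblkQ : ∀ i ∈ 𝓙, ∀ p ∈ blk i, (p : ℝ) ≤ Q) {u₀ : ℝ} (hu₀ : 0 ≤ u₀)
    (hPNT : ∀ y : ℝ, Real.exp u₀ ≤ y → Chebyshev.theta ((1 + δ) * y) - Chebyshev.theta y ≤ 2 * δ * y)
    {B B' : ℝ} (hBB' : B ≤ B')
    (hB : ∀ y : ℝ, |y| ≤ T' → ‖LSeries (restr 𝓙 blk g N) (1 + α + y * I)‖ ≤ B)
    (hBi : ∀ i ∈ 𝓙, ∀ y : ℝ, |y| ≤ T' → ‖LSeries (restr (𝓙.erase i) blk g N) (1 + α + y * I)‖ ≤ B') :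
    ∫ u : ℝ, ‖psum (mulLog (restr 𝓙 blk g N) N) ((1 + δ) * Real.exp u) - psum (mulLog (restr 𝓙 blk g N) N) (Real.exp u)‖ ^ 2 *
        Real.exp (-(2 * (1 + α) * u)) ≤
      B ^ 2 * (4 * δ ^ 2 / α) +
        B' ^ 2 * (16 * 𝓙.card ^ 2 * δ ^ 2 * Real.log Q + (2 + 4 * 𝓙.card ^ 2) * ((u₀ + 1) ^ 2 * (2 * δ ^ 2 * u₀ + 1)) +
          200 * (𝓙.card + 1) ^ 2) +
        25 / π * (240 / T' + (1920 + 520 * Real.exp 10 / α ^ 3) / T' ^ 2) := by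
  have hab : ∀ n, ‖restr 𝓙 blk g N n‖ ≤ 1 := norm_restr_le_one hgb
  have hρ0 : 0 < 1 + δ := by linarith
  have hρ1 : (1 : ℝ) ≤ 1 + δ := by linarith
  have hρ2 : 1 + δ ≤ 2 := by linarith
  have hJ0 : (0 : ℝ) ≤ 𝓙.card := Nat.cast_nonneg _
  have hlogQ : 0 ≤ Real.log Q := Real.log_nonneg hQ
  have hπ0 : 0 < π := Real.pi_pos
  have hT0 : 0 < T' := by linarith
  -- Plancherel for the short difference of `A`
  have hP := MellinPlancherel.integral_norm_sq_psumDiff_exp (a := mulLog (restr 𝓙 blk g N) N) (σ := 1 + α)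
    (θ := 1 + α / 2) (C := 2 / α) (ρ := 1 + δ) (by linarith) (summable_norm_mulLog_div_rpow hab (by linarith))
    (by linarith) (fun y hy => norm_psum_mulLog_le hab hα y hy) hρ0
  have hcast : ∀ y : ℝ, ((1 + α : ℝ) : ℂ) + y * I = (1 : ℂ) + α + y * I := fun y => by push_cast; ring
  simp only [hcast] at hP
  rw [hP]
  -- the `y`-side integrand `G = w · D`
  have hDint := integrable_normSq_mulLog_div (g := restr 𝓙 blk g N) (N := N) hab hα
  have hw5 : ∀ y : ℝ, ‖(((1 + δ : ℝ)) : ℂ) ^ ((1 : ℂ) + α + y * I) - 1‖ ^ 2 ≤ 25 := fun y => mult_le hρ1 hρ2 hα1 y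
  have hGD : ∀ y : ℝ, ‖(((1 + δ : ℝ)) : ℂ) ^ ((1 : ℂ) + α + y * I) - 1‖ ^ 2 *
      ‖LSeries (mulLog (restr 𝓙 blk g N) N) (1 + α + y * I)‖ ^ 2 / ‖(1 : ℂ) + α + y * I‖ ^ 2 =
      ‖(((1 + δ : ℝ)) : ℂ) ^ ((1 : ℂ) + α + y * I) - 1‖ ^ 2 *
      (‖LSeries (mulLog (restr 𝓙 blk g N) N) (1 + α + y * I)‖ ^ 2 / ‖(1 : ℂ) + α + y * I‖ ^ 2) := fun y => by ring
  simp_rw [hGD]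
  have hGint : Integrable fun y : ℝ => ‖(((1 + δ : ℝ)) : ℂ) ^ ((1 : ℂ) + α + y * I) - 1‖ ^ 2 *
      (‖LSeries (mulLog (restr 𝓙 blk g N) N) (1 + α + y * I)‖ ^ 2 / ‖(1 : ℂ) + α + y * I‖ ^ 2) := by
    refine hDint.bdd_mul (c := 25) (continuous_mult hρ0).aestronglyMeasurable (Filter.Eventually.of_forall fun y => ?_)
    rw [Real.norm_of_nonneg (by positivity)]; exact hw5 y
  have hGle : ∀ y : ℝ, ‖(((1 + δ : ℝ)) : ℂ) ^ ((1 : ℂ) + α + y * I) - 1‖ ^ 2 *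
      (‖LSeries (mulLog (restr 𝓙 blk g N) N) (1 + α + y * I)‖ ^ 2 / ‖(1 : ℂ) + α + y * I‖ ^ 2) ≤
      25 * (‖LSeries (mulLog (restr 𝓙 blk g N) N) (1 + α + y * I)‖ ^ 2 / ‖(1 : ℂ) + α + y * I‖ ^ 2) :=
    fun y => mul_le_mul_of_nonneg_right (hw5 y) (by positivity)
  -- split `ℝ = Iio (-T') ∪ Icc (-T') T' ∪ Ioi T'`
  have hdisj : Disjoint (Set.Iio (-T')) (Set.Icc (-T') T') :=
    Set.disjoint_left.2 fun y hy hy' => (not_le.2 (Set.mem_Iio.1 hy)) hy'.1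
  rw [← setIntegral_univ, ← Set.Iic_union_Ioi (a := T'),
    setIntegral_union (Set.Iic_disjoint_Ioi (le_refl _)) measurableSet_Ioi hGint.integrableOn hGint.integrableOn,
    ← Set.Iio_union_Icc_eq_Iic (show -T' ≤ T' by linarith),
    setIntegral_union hdisj measurableSet_Icc hGint.integrableOn hGint.integrableOn]
  -- the three pieces
  have htailR := setIntegral_Ioi_dyadic_tail_le (g := restr 𝓙 blk g N) (N := N) hab hα hα1 hT'
  have htailL := setIntegral_Iio_dyadic_tail_le (g := restr 𝓙 blk g N) (N := N) hab hα hα1 hT'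
  have hR : ∫ y in Set.Ioi T', ‖(((1 + δ : ℝ)) : ℂ) ^ ((1 : ℂ) + α + y * I) - 1‖ ^ 2 *
      (‖LSeries (mulLog (restr 𝓙 blk g N) N) (1 + α + y * I)‖ ^ 2 / ‖(1 : ℂ) + α + y * I‖ ^ 2) ≤
      25 * (240 / T' + (1920 + 520 * Real.exp 10 / α ^ 3) / T' ^ 2) := by
    calc _ ≤ ∫ y in Set.Ioi T', 25 * (‖LSeries (mulLog (restr 𝓙 blk g N) N) (1 + α + y * I)‖ ^ 2 / ‖(1 : ℂ) + α + y * I‖ ^ 2) :=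
          setIntegral_mono_on hGint.integrableOn (hDint.const_mul 25).integrableOn measurableSet_Ioi fun y _ => hGle y
      _ = 25 * ∫ y in Set.Ioi T', ‖LSeries (mulLog (restr 𝓙 blk g N) N) (1 + α + y * I)‖ ^ 2 / ‖(1 : ℂ) + α + y * I‖ ^ 2 :=
          integral_const_mul _ _
      _ ≤ _ := by gcongr
  have hL : ∫ y in Set.Iio (-T'), ‖(((1 + δ : ℝ)) : ℂ) ^ ((1 : ℂ) + α + y * I) - 1‖ ^ 2 *
      (‖LSeries (mulLog (restr 𝓙 blk g N) N) (1 + α + y * I)‖ ^ 2 / ‖(1 : ℂ) + α + y * I‖ ^ 2) ≤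
      25 * (240 / T' + (1920 + 520 * Real.exp 10 / α ^ 3) / T' ^ 2) := by
    calc _ ≤ ∫ y in Set.Iio (-T'), 25 * (‖LSeries (mulLog (restr 𝓙 blk g N) N) (1 + α + y * I)‖ ^ 2 / ‖(1 : ℂ) + α + y * I‖ ^ 2) :=
          setIntegral_mono_on hGint.integrableOn (hDint.const_mul 25).integrableOn measurableSet_Iio fun y _ => hGle y
      _ = 25 * ∫ y in Set.Iio (-T'), ‖LSeries (mulLog (restr 𝓙 blk g N) N) (1 + α + y * I)‖ ^ 2 / ‖(1 : ℂ) + α + y * I‖ ^ 2 :=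
          integral_const_mul _ _
      _ ≤ _ := by gcongr
  have hW := setIntegral_window_short_le h hg hg1 hgb hα hα1 hρ1 hρ2 hBB' hB hBi
  -- the window integrals
  have hc₀ : ∀ n, ‖mulVM (sieveOut (𝓙.biUnion blk) g) N n‖ ≤ vonMangoldt n :=
    fun n => norm_mulVM_le (norm_sieveOut_le hgb _) n
  have hci : ∀ i, ∀ n, ‖vmIn (blk i) g N n‖ ≤ vonMangoldt n := fun i n => norm_vmIn_le hgb _ n
  have hmd : ∀ (c : ℕ → ℂ), (fun y : ℝ => ‖(((1 + δ : ℝ)) : ℂ) ^ ((1 : ℂ) + α + y * I) - 1‖ ^ 2 *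
      (‖LSeries c (1 + α + y * I)‖ ^ 2 / ‖(1 : ℂ) + α + y * I‖ ^ 2)) =
      fun y : ℝ => ‖(((1 + δ : ℝ)) : ℂ) ^ ((1 : ℂ) + α + y * I) - 1‖ ^ 2 * ‖LSeries c (1 + α + y * I)‖ ^ 2 /
        ‖(1 : ℂ) + α + y * I‖ ^ 2 :=
    fun c => funext fun y => by ring
  have hI₀ : ∫ y : ℝ, ‖(((1 + δ : ℝ)) : ℂ) ^ ((1 : ℂ) + α + y * I) - 1‖ ^ 2 *
      (‖LSeries (fun n => if n.Prime then mulVM (sieveOut (𝓙.biUnion blk) g) N n else 0) (1 + α + y * I)‖ ^ 2 /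
        ‖(1 : ℂ) + α + y * I‖ ^ 2) ≤ 2 * π * ((u₀ + 1) ^ 2 * (2 * δ ^ 2 * u₀ + 1) + 2 * δ ^ 2 / α) := by
    rw [hmd]
    exact MellinPlancherel.integral_mult_normSq_LSeries_prime_le (norm_primePart_le hc₀) hδ0 hδ1 hα hu₀ hPNT
  have hIi : ∀ i ∈ 𝓙, ∫ y : ℝ, ‖(((1 + δ : ℝ)) : ℂ) ^ ((1 : ℂ) + α + y * I) - 1‖ ^ 2 *
      (‖LSeries (fun n => if n.Prime then vmIn (blk i) g N n else 0) (1 + α + y * I)‖ ^ 2 / ‖(1 : ℂ) + α + y * I‖ ^ 2) ≤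
      2 * π * ((u₀ + 1) ^ 2 * (2 * δ ^ 2 * u₀ + 1) + 4 * δ ^ 2 * Real.log Q) := by
    intro i hi
    have hPp : ∀ p ∈ blk i, p.Prime := fun p hp => h.prime_of_mem hi hp
    rw [hmd]
    exact MellinPlancherel.integral_mult_normSq_LSeries_prime_le_of_le (norm_primePart_le (hci i)) hQ
      (primePart_vmIn_support (g := g) (N := N) hPp (hblkQ i hi)) hδ0 hδ1 hα hu₀ hPNT
  have hsumI := Finset.sum_le_sum hIi
  rw [Finset.sum_const, nsmul_eq_mul] at hsumI
  obtain ⟨-, hI₁⟩ := integral_inv_normSq_line_le hα.le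
  -- collect everything
  set W₀ : ℝ := (u₀ + 1) ^ 2 * (2 * δ ^ 2 * u₀ + 1) with hW₀
  set τ : ℝ := 240 / T' + (1920 + 520 * Real.exp 10 / α ^ 3) / T' ^ 2 with hτ
  set I₀ : ℝ := ∫ y : ℝ, ‖(((1 + δ : ℝ)) : ℂ) ^ ((1 : ℂ) + α + y * I) - 1‖ ^ 2 *
      (‖LSeries (fun n => if n.Prime then mulVM (sieveOut (𝓙.biUnion blk) g) N n else 0) (1 + α + y * I)‖ ^ 2 /
        ‖(1 : ℂ) + α + y * I‖ ^ 2) with hI₀def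
  set SI : ℝ := ∑ i ∈ 𝓙, ∫ y : ℝ, ‖(((1 + δ : ℝ)) : ℂ) ^ ((1 : ℂ) + α + y * I) - 1‖ ^ 2 *
      (‖LSeries (fun n => if n.Prime then vmIn (blk i) g N n else 0) (1 + α + y * I)‖ ^ 2 / ‖(1 : ℂ) + α + y * I‖ ^ 2) with hSI
  set I₁ : ℝ := ∫ y : ℝ, 1 / ‖(1 : ℂ) + α + y * I‖ ^ 2 with hI₁def
  have hB2 : 0 ≤ B ^ 2 := sq_nonneg B
  have hB'2 : B ^ 2 ≤ B' ^ 2 := by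
    have hB0 : 0 ≤ B := by
      have := hB 0 (by rw [abs_zero]; linarith)
      exact (norm_nonneg _).trans this
    exact pow_le_pow_left₀ hB0 hBB' 2
  have e1 : 2 * B ^ 2 * I₀ ≤ 2 * B ^ 2 * (2 * π * (W₀ + 2 * δ ^ 2 / α)) :=
    mul_le_mul_of_nonneg_left hI₀ (by positivity)
  have e1' : 2 * B ^ 2 * (2 * π * W₀) ≤ 2 * B' ^ 2 * (2 * π * W₀) :=
    mul_le_mul_of_nonneg_right (by linarith) (by positivity)
  have e2 : 4 * B' ^ 2 * 𝓙.card * SI ≤ 4 * B' ^ 2 * 𝓙.card * (𝓙.card * (2 * π * (W₀ + 4 * δ ^ 2 * Real.log Q))) :=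
    mul_le_mul_of_nonneg_left hsumI (by positivity)
  have e3 : 400 * B' ^ 2 * (𝓙.card + 1) ^ 2 * I₁ ≤ 400 * B' ^ 2 * (𝓙.card + 1) ^ 2 * π :=
    mul_le_mul_of_nonneg_left hI₁ (by positivity)
  have hsum3 : (∫ y in Set.Iio (-T'), ‖(((1 + δ : ℝ)) : ℂ) ^ ((1 : ℂ) + α + y * I) - 1‖ ^ 2 *
      (‖LSeries (mulLog (restr 𝓙 blk g N) N) (1 + α + y * I)‖ ^ 2 / ‖(1 : ℂ) + α + y * I‖ ^ 2)) +
      (∫ y in Set.Icc (-T') T', ‖(((1 + δ : ℝ)) : ℂ) ^ ((1 : ℂ) + α + y * I) - 1‖ ^ 2 *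
      (‖LSeries (mulLog (restr 𝓙 blk g N) N) (1 + α + y * I)‖ ^ 2 / ‖(1 : ℂ) + α + y * I‖ ^ 2)) +
      (∫ y in Set.Ioi T', ‖(((1 + δ : ℝ)) : ℂ) ^ ((1 : ℂ) + α + y * I) - 1‖ ^ 2 *
      (‖LSeries (mulLog (restr 𝓙 blk g N) N) (1 + α + y * I)‖ ^ 2 / ‖(1 : ℂ) + α + y * I‖ ^ 2)) ≤
      50 * τ + (2 * B ^ 2 * (2 * π * (2 * δ ^ 2 / α)) + 2 * B' ^ 2 * (2 * π * W₀) +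
        4 * B' ^ 2 * 𝓙.card * (𝓙.card * (2 * π * (W₀ + 4 * δ ^ 2 * Real.log Q))) +
        400 * B' ^ 2 * (𝓙.card + 1) ^ 2 * π) := by
    have e1'' : 2 * B ^ 2 * (2 * π * (W₀ + 2 * δ ^ 2 / α)) = 2 * B ^ 2 * (2 * π * W₀) + 2 * B ^ 2 * (2 * π * (2 * δ ^ 2 / α)) := by
      ring
    linarith [hL, hR, hW, e1, e1', e2, e3]
  have hfinal : 1 / (2 * π) * (50 * τ + (2 * B ^ 2 * (2 * π * (2 * δ ^ 2 / α)) + 2 * B' ^ 2 * (2 * π * W₀) +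
      4 * B' ^ 2 * 𝓙.card * (𝓙.card * (2 * π * (W₀ + 4 * δ ^ 2 * Real.log Q))) + 400 * B' ^ 2 * (𝓙.card + 1) ^ 2 * π)) =
      B ^ 2 * (4 * δ ^ 2 / α) +
        B' ^ 2 * (16 * 𝓙.card ^ 2 * δ ^ 2 * Real.log Q + (2 + 4 * 𝓙.card ^ 2) * W₀ + 200 * (𝓙.card + 1) ^ 2) +
        25 / π * τ := by
    field_simp
    ring
  calc 1 / (2 * π) * ((∫ y in Set.Iio (-T'), ‖(((1 + δ : ℝ)) : ℂ) ^ ((1 : ℂ) + α + y * I) - 1‖ ^ 2 *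
      (‖LSeries (mulLog (restr 𝓙 blk g N) N) (1 + α + y * I)‖ ^ 2 / ‖(1 : ℂ) + α + y * I‖ ^ 2)) +
      (∫ y in Set.Icc (-T') T', ‖(((1 + δ : ℝ)) : ℂ) ^ ((1 : ℂ) + α + y * I) - 1‖ ^ 2 *
      (‖LSeries (mulLog (restr 𝓙 blk g N) N) (1 + α + y * I)‖ ^ 2 / ‖(1 : ℂ) + α + y * I‖ ^ 2)) +
      (∫ y in Set.Ioi T', ‖(((1 + δ : ℝ)) : ℂ) ^ ((1 : ℂ) + α + y * I) - 1‖ ^ 2 *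
      (‖LSeries (mulLog (restr 𝓙 blk g N) N) (1 + α + y * I)‖ ^ 2 / ‖(1 : ℂ) + α + y * I‖ ^ 2)))
      ≤ 1 / (2 * π) * (50 * τ + (2 * B ^ 2 * (2 * π * (2 * δ ^ 2 / α)) + 2 * B' ^ 2 * (2 * π * W₀) +
          4 * B' ^ 2 * 𝓙.card * (𝓙.card * (2 * π * (W₀ + 4 * δ ^ 2 * Real.log Q))) + 400 * B' ^ 2 * (𝓙.card + 1) ^ 2 * π)) :=
        mul_le_mul_of_nonneg_left hsum3 (by positivity)
    _ = _ := hfinal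

/-! ### Cauchy–Schwarz in `u` (GS03 (3.8)) for the short difference -/

/-- The `J`-integrand of the short difference is integrable over `ℝ`. [folklore] -/
theorem integrable_meanSquare_shortDiff_integrand {c : ℕ → ℂ} (hc : ∀ n, ‖c n‖ ≤ 1) (N : ℕ) {α ρ : ℝ} (hα : 0 < α)
    (hρ : 0 < ρ) :
    Integrable fun u : ℝ =>
      ‖psum (mulLog c N) (ρ * Real.exp u) - psum (mulLog c N) (Real.exp u)‖ ^ 2 * Real.exp (-(2 * (1 + α) * u)) := by
  have hmem := MellinPlancherel.memLp_two_phiDiff (a := mulLog c N) (σ := 1 + α) (θ := 1 + α / 2)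
    (C := 2 / α) (ρ := ρ) (fun y hy => norm_psum_mulLog_le hc hα y hy) (by linarith) hρ
  have hint := (memLp_two_iff_integrable_sq_norm hmem.1).1 hmem
  refine hint.congr (Filter.Eventually.of_forall fun u => ?_)
  simp only
  rw [norm_mul, Complex.norm_real, Real.norm_of_nonneg (Real.exp_pos _).le, mul_pow, ← Real.exp_nat_mul]
  ring_nf

/-- **GS03 (3.8) for the short difference**: Cauchy–Schwarz in `u` on `(log 2, log x]` (`x ≥ 1`):
`∫_{log 2}^{log x} ‖ΔA(e^u)‖ e^{-(1+2α)u} du ≤ √(J · 1/(2α))`, `J = ∫_ℝ ‖ΔA(e^u)‖² e^{-2(1+α)u} du`. [cite: GranvilleSoundararajan2003, (3.8)] -/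
theorem inner_integral_short_le_sqrt {c : ℕ → ℂ} (hc : ∀ n, ‖c n‖ ≤ 1) (N : ℕ) {x α ρ : ℝ} (hx : 1 ≤ x)
    (hα : 0 < α) (hα1 : α ≤ 1) (hρ : 1 ≤ ρ) (hρ2 : ρ ≤ 2) :
    ∫ u in Set.Ioc (Real.log 2) (Real.log x),
        ‖psum (mulLog c N) (ρ * Real.exp u) - psum (mulLog c N) (Real.exp u)‖ * Real.exp (-((1 + 2 * α) * u)) ≤
      Real.sqrt ((∫ u : ℝ, ‖psum (mulLog c N) (ρ * Real.exp u) - psum (mulLog c N) (Real.exp u)‖ ^ 2 *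
          Real.exp (-(2 * (1 + α) * u))) * (1 / (2 * α))) := by
  set μ : Measure ℝ := volume.restrict (Set.Ioc (Real.log 2) (Real.log x)) with hμ
  set f : ℝ → ℝ := fun u => ‖psum (mulLog c N) (ρ * Real.exp u) - psum (mulLog c N) (Real.exp u)‖ *
    Real.exp (-((1 + α) * u)) with hf
  set hh : ℝ → ℝ := fun u => Real.exp (-(α * u)) with hhh
  have hρ0 : 0 < ρ := by linarith
  have hfh : ∀ u, ‖psum (mulLog c N) (ρ * Real.exp u) - psum (mulLog c N) (Real.exp u)‖ * Real.exp (-((1 + 2 * α) * u)) =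
      f u * hh u := by
    intro u
    simp only [hf, hhh]
    rw [mul_assoc, ← Real.exp_add]
    congr 2
    ring
  simp_rw [hfh]
  have hfmeas : AEStronglyMeasurable f μ := by
    refine (Measurable.aestronglyMeasurable ?_)
    exact ((((MellinPlancherel.measurable_psum _).comp (Real.measurable_exp.const_mul ρ)).sub
      ((MellinPlancherel.measurable_psum _).comp Real.measurable_exp)).norm).mul (Real.measurable_exp.comp (by fun_prop))
  have hhmeas : AEStronglyMeasurable hh μ := (by fun_prop : Continuous hh).aestronglyMeasurable
  have hlog2 : 0 < Real.log 2 := Real.log_pos (by norm_num)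
  have hfbd : ∀ᵐ u ∂μ, ‖f u‖ ≤ 6 * x * (Real.log x + 1) := by
    refine ae_restrict_of_forall_mem measurableSet_Ioc fun u hu => ?_
    have h1 := shortKernel_le hc N hx (by positivity : (0:ℝ) ≤ α / 4) hρ hρ2 (p := (α / 2, u))
      ⟨⟨by simp only; linarith, by simp only; linarith⟩, hu⟩
    simp only at h1
    simp only [hf]
    convert h1 using 4
    ring
  have hhbd : ∀ᵐ u ∂μ, ‖hh u‖ ≤ 1 := by
    refine ae_restrict_of_forall_mem measurableSet_Ioc fun u hu => ?_
    simp only [hhh, Real.norm_eq_abs, abs_of_pos (Real.exp_pos _), Real.exp_le_one_iff]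
    have : 0 < u := hlog2.trans hu.1
    nlinarith
  have hfmem : MemLp f (ENNReal.ofReal 2) μ := by
    rw [ENNReal.ofReal_ofNat]; exact MemLp.of_bound hfmeas _ hfbd
  have hhmem : MemLp hh (ENNReal.ofReal 2) μ := by
    rw [ENNReal.ofReal_ofNat]; exact MemLp.of_bound hhmeas _ hhbd
  have hH := integral_mul_le_Lp_mul_Lq_of_nonneg Real.HolderConjugate.two_two
    (Filter.Eventually.of_forall fun u => by positivity)
    (Filter.Eventually.of_forall fun u => (Real.exp_pos _).le) hfmem hhmem
  have hf2 : ∫ u, f u ^ (2:ℝ) ∂μ ≤ ∫ u : ℝ, ‖psum (mulLog c N) (ρ * Real.exp u) - psum (mulLog c N) (Real.exp u)‖ ^ 2 *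
      Real.exp (-(2 * (1 + α) * u)) := by
    simp_rw [Real.rpow_two]
    have hint := integrable_meanSquare_shortDiff_integrand hc N hα hρ0
    have heq : ∀ u, f u ^ 2 = ‖psum (mulLog c N) (ρ * Real.exp u) - psum (mulLog c N) (Real.exp u)‖ ^ 2 *
        Real.exp (-(2 * (1 + α) * u)) := by
      intro u
      simp only [hf]
      rw [mul_pow, ← Real.exp_nat_mul]
      congr 2
      push_cast
      ring
    simp_rw [heq]
    exact setIntegral_le_integral hint (Filter.Eventually.of_forall fun u => by positivity)
  have hh2 : ∫ u, hh u ^ (2:ℝ) ∂μ ≤ 1 / (2 * α) := by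
    simp_rw [Real.rpow_two]
    have heq : ∀ u, hh u ^ 2 = Real.exp (-(2 * α) * u) := by
      intro u
      simp only [hhh]
      rw [← Real.exp_nat_mul]
      congr 1
      push_cast
      ring
    simp_rw [heq]
    exact setIntegral_exp_neg_le hα
  have hf2_0 : 0 ≤ ∫ u, f u ^ (2:ℝ) ∂μ := integral_nonneg fun u => by positivity
  have hh2_0 : 0 ≤ ∫ u, hh u ^ (2:ℝ) ∂μ := integral_nonneg fun u => by positivity
  calc ∫ u, f u * hh u ∂μ
      ≤ (∫ u, f u ^ (2:ℝ) ∂μ) ^ (1 / (2:ℝ)) * (∫ u, hh u ^ (2:ℝ) ∂μ) ^ (1 / (2:ℝ)) := hH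
    _ = Real.sqrt (∫ u, f u ^ (2:ℝ) ∂μ) * Real.sqrt (∫ u, hh u ^ (2:ℝ) ∂μ) := by
        rw [Real.sqrt_eq_rpow, Real.sqrt_eq_rpow]
    _ = Real.sqrt ((∫ u, f u ^ (2:ℝ) ∂μ) * ∫ u, hh u ^ (2:ℝ) ∂μ) := (Real.sqrt_mul hf2_0 _).symm
    _ ≤ _ := Real.sqrt_le_sqrt (mul_le_mul hf2 hh2 hh2_0 (hf2_0.trans hf2))

/-- Sum of squares of nonnegative reals is at most the square of their sum (seven terms). [folklore] -/
theorem sq_sum_seven_le {a b c d e f k : ℝ} (ha : 0 ≤ a) (hb : 0 ≤ b) (hc : 0 ≤ c) (hd : 0 ≤ d) (he : 0 ≤ e)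
    (hf : 0 ≤ f) (hk : 0 ≤ k) :
    a ^ 2 + b ^ 2 + c ^ 2 + d ^ 2 + e ^ 2 + f ^ 2 + k ^ 2 ≤ (a + b + c + d + e + f + k) ^ 2 := by
  have h1 : 0 ≤ a * (b + c + d + e + f + k) := mul_nonneg ha (by positivity)
  have h2 : 0 ≤ b * (c + d + e + f + k) := mul_nonneg hb (by positivity)
  have h3 : 0 ≤ c * (d + e + f + k) := mul_nonneg hc (by positivity)
  have h4 : 0 ≤ d * (e + f + k) := mul_nonneg hd (by positivity)
  have h5 : 0 ≤ e * (f + k) := mul_nonneg he (by positivity)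
  have h6 : 0 ≤ f * k := mul_nonneg hf hk
  nlinarith

set_option maxHeartbeats 800000 in
/-- The square-root bookkeeping for the short-difference mean square: if
`J ≤ 4B²δ²/α + B'²(16m²δ²Λ + (2 + 4m²)W₀ + 200(m+1)²) + (25/π)(240/T' + (1920 + 520e^{10}/α³)/T'²)` (`0 < α`,
`T' ≥ 1`, `B, B', m, Λ, W₀, δ ≥ 0`) then
`√(J/(2α)) ≤ 3Bδ/(2α) + B'(m+1)(3δ√Λ + 2√W₀ + 10)/√α + 32/√(αT') + 90/(√α T') + 47e⁵/(α²T')`. [folklore] -/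
theorem sqrt_meanSquare_short_bound_le {J B B' m Λ W₀ δ α T' : ℝ} (hα : 0 < α) (hT' : 1 ≤ T') (hB : 0 ≤ B)
    (hB' : 0 ≤ B') (hm : 0 ≤ m) (hΛ : 0 ≤ Λ) (hW₀ : 0 ≤ W₀) (hδ : 0 ≤ δ)
    (hJ : J ≤ B ^ 2 * (4 * δ ^ 2 / α) + B' ^ 2 * (16 * m ^ 2 * δ ^ 2 * Λ + (2 + 4 * m ^ 2) * W₀ + 200 * (m + 1) ^ 2) +
      25 / π * (240 / T' + (1920 + 520 * Real.exp 10 / α ^ 3) / T' ^ 2)) :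
    Real.sqrt (J * (1 / (2 * α))) ≤
      3 * B * δ / (2 * α) + B' * (m + 1) * (3 * δ * Real.sqrt Λ + 2 * Real.sqrt W₀ + 10) / Real.sqrt α +
        32 / Real.sqrt (α * T') + 90 / (Real.sqrt α * T') + 47 * Real.exp 5 / (α ^ 2 * T') := by
  have hT0 : 0 < T' := by linarith
  have hsα0 : 0 < Real.sqrt α := Real.sqrt_pos.mpr hα
  have hsα : Real.sqrt α ^ 2 = α := Real.sq_sqrt hα.le
  have hsT0 : 0 < Real.sqrt (α * T') := Real.sqrt_pos.mpr (by positivity)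
  have hsT : Real.sqrt (α * T') ^ 2 = α * T' := Real.sq_sqrt (by positivity)
  have hsΛ : Real.sqrt Λ ^ 2 = Λ := Real.sq_sqrt hΛ
  have hsW : Real.sqrt W₀ ^ 2 = W₀ := Real.sq_sqrt hW₀
  have hsΛ0 : 0 ≤ Real.sqrt Λ := Real.sqrt_nonneg _
  have hsW0 : 0 ≤ Real.sqrt W₀ := Real.sqrt_nonneg _
  have hπ3 : 1 / π ≤ 1 / 3 := one_div_le_one_div_of_le (by norm_num) Real.pi_gt_three.le
  have hπ0 : 0 < π := Real.pi_pos
  have he10 : Real.exp 10 = Real.exp 5 ^ 2 := by rw [← Real.exp_nat_mul]; norm_num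
  have he5 : 0 < Real.exp 5 := Real.exp_pos 5
  -- the seven target terms
  set t₁ : ℝ := 3 * B * δ / (2 * α) with ht₁
  set t₂ : ℝ := B' * (m + 1) * (3 * δ * Real.sqrt Λ) / Real.sqrt α with ht₂
  set t₃ : ℝ := B' * (m + 1) * (2 * Real.sqrt W₀) / Real.sqrt α with ht₃
  set t₄ : ℝ := B' * (m + 1) * 10 / Real.sqrt α with ht₄
  set t₅ : ℝ := 32 / Real.sqrt (α * T') with ht₅
  set t₆ : ℝ := 90 / (Real.sqrt α * T') with ht₆
  set t₇ : ℝ := 47 * Real.exp 5 / (α ^ 2 * T') with ht₇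
  have ht₁0 : 0 ≤ t₁ := by positivity
  have ht₂0 : 0 ≤ t₂ := by positivity
  have ht₃0 : 0 ≤ t₃ := by positivity
  have ht₄0 : 0 ≤ t₄ := by positivity
  have ht₅0 : 0 ≤ t₅ := by positivity
  have ht₆0 : 0 ≤ t₆ := by positivity
  have ht₇0 : 0 ≤ t₇ := by positivity
  have htarget : 3 * B * δ / (2 * α) + B' * (m + 1) * (3 * δ * Real.sqrt Λ + 2 * Real.sqrt W₀ + 10) / Real.sqrt α +
      32 / Real.sqrt (α * T') + 90 / (Real.sqrt α * T') + 47 * Real.exp 5 / (α ^ 2 * T') =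
      t₁ + t₂ + t₃ + t₄ + t₅ + t₆ + t₇ := by
    simp only [ht₁, ht₂, ht₃, ht₄, ht₅, ht₆, ht₇]; ring
  rw [htarget, Real.sqrt_le_left (by positivity)]
  -- the seven source terms and their comparison
  have hp1 : 0 ≤ B ^ 2 * δ ^ 2 := by positivity
  have hx1 : B ^ 2 * (4 * δ ^ 2 / α) * (1 / (2 * α)) ≤ t₁ ^ 2 := by
    have e : t₁ ^ 2 = (9 * (B ^ 2 * δ ^ 2) / 4) / α ^ 2 := by rw [ht₁, div_pow]; ring
    have e2 : B ^ 2 * (4 * δ ^ 2 / α) * (1 / (2 * α)) = (2 * (B ^ 2 * δ ^ 2)) / α ^ 2 := by field_simp; ring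
    rw [e, e2]
    exact div_le_div_of_nonneg_right (by linarith) (by positivity)
  have hx2 : B' ^ 2 * (16 * m ^ 2 * δ ^ 2 * Λ) * (1 / (2 * α)) ≤ t₂ ^ 2 := by
    have e : t₂ ^ 2 = 9 * B' ^ 2 * (m + 1) ^ 2 * δ ^ 2 * Λ / α := by
      rw [ht₂, div_pow, mul_pow, mul_pow, mul_pow, hsΛ, hsα]; ring
    rw [e]
    have e2 : B' ^ 2 * (16 * m ^ 2 * δ ^ 2 * Λ) * (1 / (2 * α)) = 8 * B' ^ 2 * m ^ 2 * δ ^ 2 * Λ / α := by field_simp; ring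
    rw [e2, div_le_div_iff_of_pos_right hα]
    have key : 8 * m ^ 2 ≤ 9 * (m + 1) ^ 2 := by nlinarith
    have hp : 0 ≤ B' ^ 2 * δ ^ 2 * Λ := by positivity
    calc 8 * B' ^ 2 * m ^ 2 * δ ^ 2 * Λ = (8 * m ^ 2) * (B' ^ 2 * δ ^ 2 * Λ) := by ring
      _ ≤ (9 * (m + 1) ^ 2) * (B' ^ 2 * δ ^ 2 * Λ) := mul_le_mul_of_nonneg_right key hp
      _ = 9 * B' ^ 2 * (m + 1) ^ 2 * δ ^ 2 * Λ := by ring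
  have hx3 : B' ^ 2 * ((2 + 4 * m ^ 2) * W₀) * (1 / (2 * α)) ≤ t₃ ^ 2 := by
    have e : t₃ ^ 2 = 4 * B' ^ 2 * (m + 1) ^ 2 * W₀ / α := by
      rw [ht₃, div_pow, mul_pow, mul_pow, mul_pow, hsW, hsα]; ring
    rw [e]
    have e2 : B' ^ 2 * ((2 + 4 * m ^ 2) * W₀) * (1 / (2 * α)) = B' ^ 2 * (1 + 2 * m ^ 2) * W₀ / α := by field_simp; ring
    rw [e2, div_le_div_iff_of_pos_right hα]
    have key : 1 + 2 * m ^ 2 ≤ 4 * (m + 1) ^ 2 := by nlinarith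
    have hp : 0 ≤ B' ^ 2 * W₀ := by positivity
    calc B' ^ 2 * (1 + 2 * m ^ 2) * W₀ = (1 + 2 * m ^ 2) * (B' ^ 2 * W₀) := by ring
      _ ≤ (4 * (m + 1) ^ 2) * (B' ^ 2 * W₀) := mul_le_mul_of_nonneg_right key hp
      _ = 4 * B' ^ 2 * (m + 1) ^ 2 * W₀ := by ring
  have hx4 : B' ^ 2 * (200 * (m + 1) ^ 2) * (1 / (2 * α)) ≤ t₄ ^ 2 := by
    have e : t₄ ^ 2 = 100 * B' ^ 2 * (m + 1) ^ 2 / α := by rw [ht₄, div_pow, mul_pow, mul_pow, hsα]; ring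
    rw [e]
    have e2 : B' ^ 2 * (200 * (m + 1) ^ 2) * (1 / (2 * α)) = 100 * B' ^ 2 * (m + 1) ^ 2 / α := by field_simp; ring
    rw [e2]
  have hx5 : 25 / π * (240 / T') * (1 / (2 * α)) ≤ t₅ ^ 2 := by
    have e : t₅ ^ 2 = 1024 / (α * T') := by rw [ht₅, div_pow, hsT]; norm_num
    rw [e]
    calc 25 / π * (240 / T') * (1 / (2 * α)) = 1 / π * (3000 / (α * T')) := by ring
      _ ≤ 1 / 3 * (3000 / (α * T')) := mul_le_mul_of_nonneg_right hπ3 (by positivity)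
      _ = 1000 / (α * T') := by ring
      _ ≤ 1024 / (α * T') := div_le_div_of_nonneg_right (by norm_num) (by positivity)
  have hx6 : 25 / π * (1920 / T' ^ 2) * (1 / (2 * α)) ≤ t₆ ^ 2 := by
    have e : t₆ ^ 2 = 8100 / (α * T' ^ 2) := by rw [ht₆, div_pow, mul_pow, hsα]; norm_num
    rw [e]
    calc 25 / π * (1920 / T' ^ 2) * (1 / (2 * α)) = 1 / π * (24000 / (α * T' ^ 2)) := by ring
      _ ≤ 1 / 3 * (24000 / (α * T' ^ 2)) := mul_le_mul_of_nonneg_right hπ3 (by positivity)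
      _ = 8000 / (α * T' ^ 2) := by ring
      _ ≤ 8100 / (α * T' ^ 2) := div_le_div_of_nonneg_right (by norm_num) (by positivity)
  have hx7 : 25 / π * ((520 * Real.exp 10 / α ^ 3) / T' ^ 2) * (1 / (2 * α)) ≤ t₇ ^ 2 := by
    have e : t₇ ^ 2 = 2209 * Real.exp 10 / (α ^ 4 * T' ^ 2) := by
      rw [ht₇, he10, div_pow, mul_pow, mul_pow]; ring
    rw [e]
    calc 25 / π * ((520 * Real.exp 10 / α ^ 3) / T' ^ 2) * (1 / (2 * α)) = 1 / π * (6500 * Real.exp 10 / (α ^ 4 * T' ^ 2)) := by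
          ring
      _ ≤ 1 / 3 * (6500 * Real.exp 10 / (α ^ 4 * T' ^ 2)) := mul_le_mul_of_nonneg_right hπ3 (by positivity)
      _ ≤ 2209 * Real.exp 10 / (α ^ 4 * T' ^ 2) := by
          rw [← mul_div_assoc, div_le_div_iff_of_pos_right (by positivity)]
          have : 0 < Real.exp 10 := Real.exp_pos _
          linarith
  have hsplit : J * (1 / (2 * α)) ≤
      B ^ 2 * (4 * δ ^ 2 / α) * (1 / (2 * α)) + B' ^ 2 * (16 * m ^ 2 * δ ^ 2 * Λ) * (1 / (2 * α)) +
        B' ^ 2 * ((2 + 4 * m ^ 2) * W₀) * (1 / (2 * α)) + B' ^ 2 * (200 * (m + 1) ^ 2) * (1 / (2 * α)) +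
        25 / π * (240 / T') * (1 / (2 * α)) + 25 / π * (1920 / T' ^ 2) * (1 / (2 * α)) +
        25 / π * ((520 * Real.exp 10 / α ^ 3) / T' ^ 2) * (1 / (2 * α)) := by
    have h := mul_le_mul_of_nonneg_right hJ (show 0 ≤ 1 / (2 * α) by positivity)
    have e : (B ^ 2 * (4 * δ ^ 2 / α) + B' ^ 2 * (16 * m ^ 2 * δ ^ 2 * Λ + (2 + 4 * m ^ 2) * W₀ + 200 * (m + 1) ^ 2) +
        25 / π * (240 / T' + (1920 + 520 * Real.exp 10 / α ^ 3) / T' ^ 2)) * (1 / (2 * α)) =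
        B ^ 2 * (4 * δ ^ 2 / α) * (1 / (2 * α)) + B' ^ 2 * (16 * m ^ 2 * δ ^ 2 * Λ) * (1 / (2 * α)) +
        B' ^ 2 * ((2 + 4 * m ^ 2) * W₀) * (1 / (2 * α)) + B' ^ 2 * (200 * (m + 1) ^ 2) * (1 / (2 * α)) +
        25 / π * (240 / T') * (1 / (2 * α)) + 25 / π * (1920 / T' ^ 2) * (1 / (2 * α)) +
        25 / π * ((520 * Real.exp 10 / α ^ 3) / T' ^ 2) * (1 / (2 * α)) := by
      ring
    linarith
  have hsq := sq_sum_seven_le ht₁0 ht₂0 ht₃0 ht₄0 ht₅0 ht₆0 ht₇0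
  linarith

/-- **The inner integral for the short difference, per `α`** (GS03 (3.8) with the short-difference mean
square): under the hypotheses of `meanSquare_shortDiff_mulLog_restr_le` and `x ≥ 1`,
`∫_{log 2}^{log x} ‖A(ρe^u) - A(e^u)‖ e^{-(1+2α)u} du
   ≤ 3Bδ/(2α) + B'(J+1)(3δ√(log Q) + 2√W₀ + 10)/√α + 32/√(αT') + 90/(√α T') + 47e⁵/(α²T')`,
`W₀ = (u₀+1)²(2δ²u₀+1)`: the main term `Bδ/α` carries the refined window bound `B` for `𝒢_a` with the length `δ`
of the interval; `B' ≥ B` is any bound for the `𝒢_{a_i}`.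
[cite: GranvilleSoundararajan2003, (3.8) and Lemma 3.2] -/
theorem inner_integral_short_le [DecidableEq ι] (h : IsBlockSystem 𝓙 blk N)
    (hg : ∀ m n, g (m * n) = g m * g n) (hg1 : g 1 = 1) (hgb : ∀ n, ‖g n‖ ≤ 1) {x : ℝ} (hx : 1 ≤ x)
    {α : ℝ} (hα : 0 < α) (hα1 : α ≤ 1) {δ : ℝ} (hδ0 : 0 < δ) (hδ1 : δ ≤ 1) {T' : ℝ} (hT' : 1 ≤ T')
    {Q : ℝ} (hQ : 1 ≤ Q) (hblkQ : ∀ i ∈ 𝓙, ∀ p ∈ blk i, (p : ℝ) ≤ Q) {u₀ : ℝ} (hu₀ : 0 ≤ u₀)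
    (hPNT : ∀ y : ℝ, Real.exp u₀ ≤ y → Chebyshev.theta ((1 + δ) * y) - Chebyshev.theta y ≤ 2 * δ * y)
    {B B' : ℝ} (hB0 : 0 ≤ B) (hBB' : B ≤ B')
    (hB : ∀ y : ℝ, |y| ≤ T' → ‖LSeries (restr 𝓙 blk g N) (1 + α + y * I)‖ ≤ B)
    (hBi : ∀ i ∈ 𝓙, ∀ y : ℝ, |y| ≤ T' → ‖LSeries (restr (𝓙.erase i) blk g N) (1 + α + y * I)‖ ≤ B') :
    ∫ u in Set.Ioc (Real.log 2) (Real.log x),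
        ‖psum (mulLog (restr 𝓙 blk g N) N) ((1 + δ) * Real.exp u) - psum (mulLog (restr 𝓙 blk g N) N) (Real.exp u)‖ *
          Real.exp (-((1 + 2 * α) * u)) ≤
      3 * B * δ / (2 * α) +
        B' * (𝓙.card + 1) * (3 * δ * Real.sqrt (Real.log Q) + 2 * Real.sqrt ((u₀ + 1) ^ 2 * (2 * δ ^ 2 * u₀ + 1)) + 10) /
          Real.sqrt α +
        32 / Real.sqrt (α * T') + 90 / (Real.sqrt α * T') + 47 * Real.exp 5 / (α ^ 2 * T') := by
  have hab : ∀ n, ‖restr 𝓙 blk g N n‖ ≤ 1 := norm_restr_le_one hgb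
  have h1 := inner_integral_short_le_sqrt hab N hx hα hα1 (ρ := 1 + δ) (by linarith) (by linarith)
  have hJ := meanSquare_shortDiff_mulLog_restr_le h hg hg1 hgb hα hα1 hδ0 hδ1 hT' hQ hblkQ hu₀ hPNT hBB' hB hBi
  refine h1.trans (sqrt_meanSquare_short_bound_le hα hT' hB0 (hB0.trans hBB') (Nat.cast_nonneg _) (Real.log_nonneg hQ)
    (by positivity) hδ0.le hJ)

/-! ### The assembled bound for the short difference -/

/-- The inner integral `α ↦ I(α)` of the short difference is integrable on `(α₀, 1]` (`α₀ ≥ 0`). [folklore] -/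
theorem integrableOn_inner_short {c : ℕ → ℂ} (hc : ∀ n, ‖c n‖ ≤ 1) (N : ℕ) {x α₀ ρ : ℝ} (hx : 1 ≤ x)
    (hα₀ : 0 ≤ α₀) (hρ : 1 ≤ ρ) (hρ2 : ρ ≤ 2) :
    IntegrableOn (fun α => ∫ u in Set.Ioc (Real.log 2) (Real.log x),
        ‖psum (mulLog c N) (ρ * Real.exp u) - psum (mulLog c N) (Real.exp u)‖ * Real.exp (-((1 + 2 * α) * u)))
      (Set.Ioc α₀ 1) :=
  (integrable_shortKernel hc N hx hα₀ hρ hρ2).integral_prod_left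

/-- **Halász's chain for the short difference of a block-restricted sum, up to the `α`-integration.**
Let `C` be the constant of `Halasz.exists_sum_abs_psi_sub_mul_kk_le`, `a = g̃ 1_𝒮` for a block system at level `N`
(`g` completely multiplicative, `|g| ≤ 1`), `∑_{p ∈ E} log p/p ≤ L`, `x ≥ 3`, `1 ≤ ρ ≤ 2`.  Then
`‖S_a(ρx) - S_a(x)‖ log x ≤ x (17 ∫_{1/(2 log x)}^1 I(α) dα + (ρ-1)²(log log x + 1) + (ρ-1))
   + (3C + 10 + 2L(ρ-1)) x + |E| log(2x)`,
`I(α) = ∫_{log 2}^{log x} ‖A(ρe^u) - A(e^u)‖ e^{-(1+2α)u} du` (bounded per `α` by `inner_integral_short_le`).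
[cite: GranvilleSoundararajan2003, §§2–3] -/
theorem norm_shortDiff_restr_le_integral {C : ℝ}
    (hC : ∀ x : ℝ, 3 ≤ x → ∑ d ∈ Finset.Icc 1 ⌊x⌋₊, |Chebyshev.psi d - d| * kk x d ≤ C * x)
    [DecidableEq ι] (h : IsBlockSystem 𝓙 blk N) (hg : ∀ m n, g (m * n) = g m * g n)
    (hgb : ∀ n, ‖g n‖ ≤ 1) {L : ℝ} (hL : ∑ p ∈ 𝓙.biUnion blk, Real.log p / p ≤ L) {x ρ : ℝ} (hx : 3 ≤ x)
    (hρ : 1 ≤ ρ) (hρ2 : ρ ≤ 2) :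
    ‖S (restr 𝓙 blk g N) (ρ * x) - S (restr 𝓙 blk g N) x‖ * Real.log x ≤
      x * (17 * (∫ α in Set.Ioc (1 / (2 * Real.log x)) 1,
              ∫ u in Set.Ioc (Real.log 2) (Real.log x),
                ‖psum (mulLog (restr 𝓙 blk g N) N) (ρ * Real.exp u) - psum (mulLog (restr 𝓙 blk g N) N) (Real.exp u)‖ *
                  Real.exp (-((1 + 2 * α) * u))) +
            ((ρ - 1) ^ 2 * (Real.log (Real.log x) + 1) + (ρ - 1))) +
        (3 * C + 10 + 2 * L * (ρ - 1)) * x + (𝓙.biUnion blk).card * Real.log (2 * x) := by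
  have h1 := norm_shortDiff_restr_mul_log_le_integral hC h hg hgb hL hx hρ hρ2
  have h2 := integral_shortDiffExp_le (𝓙 := 𝓙) (blk := blk) (N := N) hgb hx hρ hρ2
  have hx0 : 0 < x := by linarith
  nlinarith [mul_le_mul_of_nonneg_left h2 hx0.le]

end Restricted

end Halasz

end Literature.NumberTheory.LFunctions
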